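import Literature.Topology.FourManifolds.FlowerTipGeometry
import Literature.Topology.FourManifolds.FlowerSymmetry
import Literature.Topology.FourManifolds.FlowerValleyArc
import Literature.Topology.FourManifolds.PlanarDoubleRetraction
import HarnessLib

/-!
# Collars of the valley arcs: the fan collar deformations (one edge, two edges)

Topic `Literature/Topology/FourManifolds`; fact seat
`provefact-Literature.Topology.FourManifolds.exists-cbed50d78a` (named fact (g′)
`Literature.Topology.FourManifolds.exists_marking_centralSurface_of_gkTrisection`), sequel of
`FlowerTipGeometry.lean` (§6 valley coordinates `valleyR`), `FlowerValleyArc.lean` (the valley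
arc `vArcSet`) and `PlanarDoubleRetraction.lean` (§4, lifting seam-preserving deformations).
Seifert–van Kampen for the decomposition of the flower surface `Z` into its `g` sectors ("melon")
needs, for each valley arc, an open collar in the adjacent pieces which strong deformation
retracts onto the arc (`VanKampenClosedCoverPushout.lean`).  The pieces on one side of the
standard valley arc (over `θ = π/g`) are the **fans** `S₀ ∪ S₋₁ ∪ … ∪ S₋ₘ` of consecutive sectors
below it; this file constructs their collars:

* §1 `ang μ` — the angle measured continuously in the frame centred at `μ` (`u = pol ‖u‖ (ang μ u)`,
  `ang μ (pol r θ) = θ` for `θ - μ ∈ (-π, π]`, continuity off the cut);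
* §2 `Rtot` — the valley radius `valleyR` made total and continuous on `ℝ × ℝ` by clamping its
  arguments (`flower_pol_Rtot`, `Rtot_eq`);
* §3 angular monotonicity: for fixed radius `q` decreases from the peak ray to the valley ray;
* §4 the planar fan `fanW g m = {q ≤ c, ang ∈ [-(2m+1)π/g, π/g]}` (frame centre `μ_m = -mπ/g`,
  `m + 2 ≤ g`), the open **collar region** `collarU g m` (a disc of radius `1/4` about the origin
  together with the upper valley half-zone `π/(2g) < ang < π/g + π/(2g)`), and the **fan collar
  deformation** `fanψ`: rotate the angle linearly to `π/g`, keeping the radius near the origin and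
  keeping the flower value far from it (new radius `Rtot θ_s (q u) ≥ ‖u‖`), blended by `λ(‖u‖)`.
  It maps `fan ∩ collar` into itself (`fanψ_mem`), stays in the domain, maps seam points to seam
  points (`flower_fanψ_eq`: seam points have `‖u‖ ≥ ρ₁ > 1/2`, where the blend is purely
  flower-preserving), is the identity at `s = 0`, lands on the valley ray segment at `s = 1`, fixes
  the segment, and is continuous (at the origin since it preserves small norms).  Lifting:
  **`isStrongDeformationRetractOf_vArcSet_fan` — over the open collar region, the flower surface
  over the fan strong deformation retracts onto the valley arc**; `isOpen_collarU`.

* §5 angular cones `cone a b` (two closed half-planes: convex), `ang_mem_of_mem_cone`.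
* §6 the **two-edged fan** `fanF g k = S₁ ∪ … ∪ S_k` (angles `[π/g, (2k+1)π/g]`, bisector
  `μ_k = (k+1)π/g`, `1 ≤ k ≤ g - 1`), its collar region `collarU2` (small disc plus the two inner
  valley half-zones; open) and the collar deformation `Ψ2` onto BOTH edge ray segments `vRay2`:
  on the lower half `loΦ` = straight-line **fold** `u ↦ (1-s)u + s·pol(‖u‖(μ-θ)/(μ-π/g)) (π/g)`
  near the origin, flower-preserving squeeze `farPt` towards the lower edge far from it, blended by
  `λ₂(‖u‖)` (`λ₂ = 0` on `[0, 1/8]`, `1` on `[1/4, ∞)`; near the origin everything has norm `< 1/2`,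
  `Rtot_lt_half`, so the blend stays in the domain; angles are controlled by the cones); on the
  upper half its conjugate by the **bisector reflection** `bisRefl = rot(ζ^{k+1}) ∘ refl`, a
  symmetry of the flower swapping the edges; the branches agree on the bisector (where the domain
  is the small disc and both are `(1-s)u`), whence continuity by pointwise pasting.  Lifting:
  **`isStrongDeformationRetractOf_vRay2`** — the flower surface over `fanF ∩ collarU2` strong
  deformation retracts onto its part over the two edge ray segments; `isOpen_collarU2`.

Everything is proved; no named facts.

## References

* A. Hatcher, *Algebraic Topology*, CUP (2002), §1.2, Thm. 1.20 (van Kampen; neighbourhoods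
  deformation retracting onto the pieces). [HatcherAT2002]
-/

open scoped Manifold ContDiff Topology InnerProductSpace Real
open Set Function Filter Metric Module Complex

noncomputable section

namespace Literature.Topology.FourManifolds

/-- Local notation: `𝔼 n` is the model Euclidean space `EuclideanSpace ℝ (Fin n)`. -/
local notation "𝔼 " n:arg => EuclideanSpace ℝ (Fin n)

open PlanarThickening PlanarDouble Literature.AlgebraicTopology.Homotopy

namespace FlowerModel

variable {g : ℕ}

/-! ### §1 The angle in a rotated frame -/

/-- **The angle of a planar point measured in the frame centred at `μ`**: the unique
`θ ∈ (μ - π, μ + π]` with `u = pol ‖u‖ θ` (for `u ≠ 0`); `ang μ 0 = μ`. [folklore] -/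
def ang (μ : ℝ) (u : 𝔼 2) : ℝ := Complex.arg (toC u * Complex.exp (-(μ * I))) + μ

/-- The rotated complex coordinate. [folklore] -/
theorem toC_mul_exp_pol (μ r θ : ℝ) :
    toC (pol r θ) * Complex.exp (-(μ * I)) = r * Complex.exp ((θ - μ : ℝ) * I) := by
  rw [toC_pol, mul_assoc, ← Complex.exp_add]
  push_cast
  ring_nf

/-- **The rotated angle of a polar point.** [folklore] -/
theorem ang_pol {μ r θ : ℝ} (hr : 0 < r) (hθ : θ - μ ∈ Ioc (-π) π) : ang μ (pol r θ) = θ := by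
  rw [ang, toC_mul_exp_pol, Complex.arg_real_mul _ hr, Complex.arg_exp_mul_I,
    (toIocMod_eq_self Real.two_pi_pos).2 ⟨by linarith [hθ.1], by linarith [hθ.2]⟩]
  ring

/-- The rotated angle of the origin is the centre of the frame. [folklore] -/
@[simp] theorem ang_zero (μ : ℝ) : ang μ (0 : 𝔼 2) = μ := by
  rw [ang, map_zero, zero_mul, Complex.arg_zero, zero_add]

/-- The rotated angle lies in `(μ - π, μ + π]`. [folklore] -/
theorem ang_mem (μ : ℝ) (u : 𝔼 2) : ang μ u ∈ Ioc (μ - π) (μ + π) := by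
  have h1 := Complex.neg_pi_lt_arg (toC u * Complex.exp (-(μ * I)))
  have h2 := Complex.arg_le_pi (toC u * Complex.exp (-(μ * I)))
  rw [ang]; exact ⟨by linarith, by linarith⟩

/-- The standard angle is the argument. [folklore] -/
theorem ang_zero_left (u : 𝔼 2) : ang 0 u = Complex.arg (toC u) := by
  rw [ang]; simp

/-- **Polar decomposition in the rotated frame**: `u = pol ‖u‖ (ang μ u)`. [folklore] -/
theorem pol_norm_ang (μ : ℝ) (u : 𝔼 2) : pol ‖u‖ (ang μ u) = u := by
  apply toC.injective
  set z := toC u * Complex.exp (-(μ * I)) with hz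
  have hnz : ‖z‖ = ‖u‖ := by
    rw [hz, norm_mul, Complex.norm_exp, norm_toC]
    simp
  rw [toC_pol, ang]
  push_cast
  rw [add_mul, Complex.exp_add, ← mul_assoc, ← hnz]
  have key : (‖z‖ : ℂ) * Complex.exp (Complex.arg z * I) = z := Complex.norm_mul_exp_arg_mul_I z
  rw [key, hz, mul_assoc, ← Complex.exp_add]
  have : -(↑μ * I) + ↑μ * I = 0 := by ring
  rw [this, Complex.exp_zero, mul_one]

/-- The rotated coordinate of a non-zero point off the cut `ang = μ + π` lies in the slit plane.
[folklore] -/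
theorem mem_slitPlane_of_ang_ne {μ : ℝ} {u : 𝔼 2} (hu : u ≠ 0) (h : ang μ u ≠ μ + π) :
    toC u * Complex.exp (-(μ * I)) ∈ Complex.slitPlane := by
  rw [Complex.mem_slitPlane_iff_arg]
  refine ⟨fun h' => h (by rw [ang, h']; ring), ?_⟩
  refine mul_ne_zero (fun h0 => hu ?_) (Complex.exp_ne_zero _)
  rw [← norm_eq_zero, ← norm_toC, h0, norm_zero]

/-- **The rotated angle is continuous** away from the origin and off the cut `ang = μ + π`. [folklore] -/
theorem continuousAt_ang {μ : ℝ} {u : 𝔼 2} (hu : u ≠ 0) (h : ang μ u ≠ μ + π) :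
    ContinuousAt (ang μ) u := by
  unfold ang
  refine ContinuousAt.add ?_ continuousAt_const
  have hc : Continuous fun v : 𝔼 2 => toC v * Complex.exp (-(μ * I)) := toC.continuous.mul continuous_const
  exact ContinuousAt.comp (f := fun v : 𝔼 2 => toC v * Complex.exp (-(μ * I))) (g := Complex.arg)
    (x := u) (Complex.continuousAt_arg (mem_slitPlane_of_ang_ne hu h)) hc.continuousAt

/-- Points with rotated angle in a window `[μ - w, μ + w]`, `w < π`, are off the cut. [folklore] -/
theorem ang_ne_of_abs_le {μ w : ℝ} (hw : w < π) {u : 𝔼 2} (h : |ang μ u - μ| ≤ w) : ang μ u ≠ μ + π := by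
  intro h'
  rw [h', add_sub_cancel_left, abs_of_pos Real.pi_pos] at h
  linarith

/-! ### §2 The total valley radius -/

/-- The valley zone clamp of an angle. [folklore] -/
def clampθ (g : ℕ) (θ : ℝ) : ℝ := max (π / (2 * g)) (min (3 * π / (2 * g)) θ)

/-- The clamped angle lies in the valley zone (`g ≥ 1`). [folklore] -/
theorem clampθ_mem (hg : 1 ≤ g) (θ : ℝ) : clampθ g θ ∈ Icc (π / (2 * g)) (3 * π / (2 * (g : ℝ))) := by
  have hg' : (0 : ℝ) < g := by exact_mod_cast (show 0 < g by omega)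
  have hle : π / (2 * g) ≤ 3 * π / (2 * g) := by
    rw [div_le_div_iff₀ (mul_pos two_pos hg') (mul_pos two_pos hg')]; nlinarith [Real.pi_pos]
  refine ⟨le_max_left _ _, max_le hle (min_le_left _ _)⟩

/-- On the valley zone the clamp is the identity. [folklore] -/
theorem clampθ_of_mem {θ : ℝ} (h : θ ∈ Icc (π / (2 * g)) (3 * π / (2 * (g : ℝ)))) : clampθ g θ = θ := by
  rw [clampθ, min_eq_right h.2, max_eq_right h.1]

/-- The clamp is continuous. [folklore] -/
theorem continuous_clampθ : Continuous (clampθ g) := by unfold clampθ; fun_prop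

/-- The maximal flower value along the ray of a valley-zone angle (attained at radius `ρ₄`). [folklore] -/
def vmax (hg : 2 ≤ g) (θ : ℝ) : ℝ := flower g (pol (rho4 hg) θ)

/-- `vmax` is continuous. [folklore] -/
theorem continuous_vmax (hg : 2 ≤ g) : Continuous (vmax hg) := by
  unfold vmax
  show Continuous (flower g ∘ (fun x : ℝ × ℝ => pol x.1 x.2) ∘ fun θ : ℝ => (rho4 hg, θ))
  exact contDiff_flower.continuous.comp (continuous_pol.comp (continuous_const.prodMk continuous_id))

/-- `c ≤ vmax`. [folklore] -/
theorem level_le_vmax (hg : 2 ≤ g) (θ : ℝ) : level g ≤ vmax hg θ := level_le_flower_pol_rho4 hg θ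

/-- The clamp of a value to `[0, vmax (clampθ θ)]`. [folklore] -/
def clampv (hg : 2 ≤ g) (θ v : ℝ) : ℝ := max 0 (min (vmax hg (clampθ g θ)) v)

/-- The clamped value lies in the admissible range. [folklore] -/
theorem clampv_mem (hg : 2 ≤ g) (θ v : ℝ) : 0 ≤ clampv hg θ v ∧ clampv hg θ v ≤ vmax hg (clampθ g θ) :=
  ⟨le_max_left _ _, max_le (le_trans (level_pos (by omega)).le (level_le_vmax hg _)) (min_le_left _ _)⟩

/-- On the admissible range the value clamp is the identity. [folklore] -/
theorem clampv_of_mem (hg : 2 ≤ g) {θ v : ℝ} (h0 : 0 ≤ v) (h1 : v ≤ vmax hg (clampθ g θ)) : clampv hg θ v = v := by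
  rw [clampv, min_eq_right h1, max_eq_right h0]

/-- The value clamp is continuous. [folklore] -/
theorem continuous_clampv (hg : 2 ≤ g) : Continuous fun x : ℝ × ℝ => clampv hg x.1 x.2 := by
  unfold clampv
  have h : Continuous fun x : ℝ × ℝ => vmax hg (clampθ g x.1) :=
    ((continuous_vmax hg).comp (continuous_clampθ (g := g))).comp continuous_fst
  exact continuous_const.max (h.min continuous_snd)

/-- The clamped pair lies in the range of the valley coordinates. [folklore] -/
theorem clamp_mem_range (hg : 2 ≤ g) (θ v : ℝ) : (clampθ g θ, clampv hg θ v) ∈ range (Λv hg) :=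
  (mem_range_Λv_iff hg).2 ⟨clampθ_mem (by omega) θ, (clampv_mem hg θ v).1, (clampv_mem hg θ v).2⟩

/-- **The total valley radius**: the valley radius of the clamped data — a continuous function on
all of `ℝ × ℝ` which agrees with `valleyR` on the range of the valley coordinates. [folklore] -/
def Rtot (hg : 2 ≤ g) (θ v : ℝ) : ℝ := valleyR hg ⟨(clampθ g θ, clampv hg θ v), clamp_mem_range hg θ v⟩

/-- The total valley radius is continuous. [folklore] -/
theorem continuous_Rtot (hg : 2 ≤ g) : Continuous fun x : ℝ × ℝ => Rtot hg x.1 x.2 := by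
  unfold Rtot
  refine (continuous_valleyR hg).comp (Continuous.subtype_mk ?_ _)
  exact (continuous_clampθ.comp continuous_fst).prodMk (continuous_clampv hg)

/-- The total valley radius lies in `[0, ρ₄]`. [folklore] -/
theorem Rtot_mem (hg : 2 ≤ g) (θ v : ℝ) : Rtot hg θ v ∈ Icc 0 (rho4 hg) := (valleyR_spec hg _).1

/-- **Defining property** on admissible data: `q(pol (Rtot θ v) θ) = v`. [folklore] -/
theorem flower_pol_Rtot (hg : 2 ≤ g) {θ v : ℝ} (hθ : θ ∈ Icc (π / (2 * g)) (3 * π / (2 * (g : ℝ))))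
    (h0 : 0 ≤ v) (h1 : v ≤ vmax hg θ) : flower g (pol (Rtot hg θ v) θ) = v := by
  have hc : clampθ g θ = θ := clampθ_of_mem hθ
  have hv : clampv hg θ v = v := clampv_of_mem hg h0 (by rw [hc]; exact h1)
  have h := (valleyR_spec hg ⟨(clampθ g θ, clampv hg θ v), clamp_mem_range hg θ v⟩).2
  simp only [hc, hv] at h
  rw [Rtot]
  convert h using 3; simp [hc, hv]

/-- **Uniqueness** on admissible data: the radius with `q(pol r θ) = v` is `Rtot θ v`. [folklore] -/
theorem Rtot_eq (hg : 2 ≤ g) {θ v r : ℝ} (hθ : θ ∈ Icc (π / (2 * g)) (3 * π / (2 * (g : ℝ))))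
    (h0 : 0 ≤ v) (h1 : v ≤ vmax hg θ) (hr : 0 ≤ r) (h : flower g (pol r θ) = v) : Rtot hg θ v = r := by
  have hmono := strictMonoOn_flower_pol_of_cos_nonpos hg (cos_nonpos_of_mem (by omega) hθ.1 hθ.2)
  refine (hmono.injOn ((Rtot_mem hg θ v).1 : Rtot hg θ v ∈ Ici (0:ℝ)) (hr : r ∈ Ici (0:ℝ)) ?_)
  rw [flower_pol_Rtot hg hθ h0 h1, h]

/-- Values of the flower on the domain are admissible: `0 ≤ q u` for every `u`... on rays:
`0 ≤ q(pol r θ)` for `r ≥ 0` (as `q ≥ vprof ≥ 0`). [folklore] -/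
theorem flower_pol_nonneg (hg : 2 ≤ g) {r : ℝ} (hr : 0 ≤ r) (θ : ℝ) : 0 ≤ flower g (pol r θ) := by
  have h1 := vprof_le_flower_pol (g := g) hr θ
  have h2 : 0 ≤ vprof g r := by
    have hm := (strictMonoOn_vprof hg).monotoneOn (self_mem_Ici : (0:ℝ) ∈ Ici 0) (hr : r ∈ Ici (0:ℝ)) hr
    have h0 : vprof g 0 = 0 := by rw [vprof, V_zero (by omega)]; ring
    rw [h0] at hm; exact hm
  linarith

/-- `q u ≥ 0` everywhere. [folklore] -/
theorem flower_nonneg (hg : 2 ≤ g) (u : 𝔼 2) : 0 ≤ flower g u := by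
  rw [← pol_norm_ang 0 u]; exact flower_pol_nonneg hg (norm_nonneg u) _

/-- On the domain, values are at most `vmax θ` for every valley-zone... indeed every angle. [folklore] -/
theorem flower_le_vmax_of_le (hg : 2 ≤ g) {u : 𝔼 2} (hu : flower g u ≤ level g) (θ : ℝ) :
    flower g u ≤ vmax hg θ :=
  le_trans hu (level_le_vmax hg θ)

/-! ### §3 Angular monotonicity of the flower -/

/-- **For fixed radius the flower decreases as the angle moves from the peak ray `0` towards the
valley ray `π/g`**: `0 ≤ θ ≤ θ' ≤ π/g` gives `q(pol r θ') ≤ q(pol r θ)` (`r ≥ 0`). [folklore] -/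
theorem flower_pol_le_of_angle_le (hg : 1 ≤ g) {r : ℝ} (hr : 0 ≤ r) {θ θ' : ℝ} (h0 : 0 ≤ θ) (hle : θ ≤ θ')
    (h1 : θ' ≤ π / g) : flower g (pol r θ') ≤ flower g (pol r θ) := by
  have hg' : (0 : ℝ) < g := by exact_mod_cast (show 0 < g by omega)
  rw [flower_pol, flower_pol]
  have hcos : Real.cos (g * θ') ≤ Real.cos (g * θ) := by
    apply Real.cos_le_cos_of_nonneg_of_le_pi (by positivity)
    · rw [le_div_iff₀ hg'] at h1; nlinarith [Real.pi_pos]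
    · exact mul_le_mul_of_nonneg_left hle hg'.le
  nlinarith [V_nonneg (g := g) hr]

/-- The same on the lower side: `-π/g ≤ θ' ≤ θ ≤ 0` gives `q(pol r θ') ≤ q(pol r θ)` (`r ≥ 0`). [folklore] -/
theorem flower_pol_le_of_angle_le_neg (hg : 1 ≤ g) {r : ℝ} (hr : 0 ≤ r) {θ θ' : ℝ} (h0 : θ ≤ 0)
    (hle : θ' ≤ θ) (h1 : -(π / g) ≤ θ') : flower g (pol r θ') ≤ flower g (pol r θ) := by
  rw [← flower_pol_neg r θ', ← flower_pol_neg r θ]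
  exact flower_pol_le_of_angle_le hg hr (by linarith) (by linarith) (by linarith)


/-! ### §4 The fan of sectors below the standard valley ray and its collar deformation -/

/-- The centre `μ_m = -mπ/g` of the angular frame of the fan of the `m + 1` sectors
`S₀, S₋₁, …, S₋ₘ`. [folklore] -/
def μm (g m : ℕ) : ℝ := -(m * π / g)

variable (g) in
/-- **The planar fan** of the `m + 1` sectors below the standard valley ray `θ = π/g`: the points
of the flower domain with (rotated) angle in `[-(2m+1)π/g, π/g]`. [folklore] -/
def fanW (m : ℕ) : Set (𝔼 2) :=
  {u | flower g u ≤ level g ∧ ang (μm g m) u ∈ Icc (-((2 * m + 1) * π / g)) (π / g)}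

variable (g) in
/-- **The planar collar region**: a small disc about the origin together with the upper valley
half-zone `π/(2g) < angle < π/g + π/(2g)` (an open set). [folklore] -/
def collarU (m : ℕ) : Set (𝔼 2) :=
  ball 0 (1 / 4) ∪ {u | u ≠ 0 ∧ π / (2 * g) < ang (μm g m) u ∧ ang (μm g m) u < π / g + π / (2 * g)}

variable (g) in
/-- **The valley ray segment** `{pol r (π/g) : 0 ≤ r ≤ ρ₄}`. [folklore] -/
def vRay (hg : 2 ≤ g) : Set (𝔼 2) := (fun r => pol r (π / g)) '' Icc 0 (rho4 hg)

/-- The blend weight `λ(r)`: `0` for `r ≤ 1/4`, `1` for `r ≥ 1/2`, affine in between. [folklore] -/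
def lam (r : ℝ) : ℝ := max 0 (min 1 (4 * r - 1))

/-- `λ` is continuous. [folklore] -/
theorem continuous_lam : Continuous lam := by unfold lam; fun_prop

/-- `0 ≤ λ ≤ 1`. [folklore] -/
theorem lam_mem (r : ℝ) : lam r ∈ Icc (0 : ℝ) 1 := ⟨le_max_left _ _, max_le zero_le_one (min_le_left _ _)⟩

/-- `λ = 0` on `[0, 1/4]`. [folklore] -/
theorem lam_eq_zero {r : ℝ} (hr : r ≤ 1 / 4) : lam r = 0 := by
  rw [lam, max_eq_left]; exact min_le_of_right_le (by linarith)

/-- `λ = 1` on `[1/2, ∞)`. [folklore] -/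
theorem lam_eq_one {r : ℝ} (hr : 1 / 2 ≤ r) : lam r = 1 := by
  rw [lam, min_eq_left (by linarith), max_eq_right zero_le_one]

/-- The squeezed angle `θ_s = θ + s (π/g - θ)`. [folklore] -/
def sqAng (g m : ℕ) (s : ℝ) (u : 𝔼 2) : ℝ := ang (μm g m) u + s * (π / g - ang (μm g m) u)

/-- **The fan collar deformation**: rotate towards the valley ray, preserving the radius near the
origin and the flower value far from it (blended by `λ(‖u‖)`):
`ψ_s(u) = pol (r + λ(r) (R_s - r)) θ_s`, `R_s = Rtot θ_s (q u)`. [folklore] -/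
def fanψ (hg : 2 ≤ g) (m : ℕ) (s : ℝ) (u : 𝔼 2) : 𝔼 2 :=
  pol (‖u‖ + lam ‖u‖ * (Rtot hg (sqAng g m s u) (flower g u) - ‖u‖)) (sqAng g m s u)

/-- Numerology of the frame: `π/g - μ_m = (m+1)π/g < π` and the fan window. [folklore] -/
theorem fan_window (hg : 2 ≤ g) {m : ℕ} (hm : m + 2 ≤ g) : (m + 1) * π / g < π ∧ 0 < π / (2 * (g : ℝ)) ∧ π / g + π / (2 * g) ≤ μm g m + π ∧
    μm g m - π < -((2 * m + 1) * π / g) := by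
  have hg' : (0 : ℝ) < g := by exact_mod_cast (show 0 < g by omega)
  have hm' : (m : ℝ) + 2 ≤ g := by exact_mod_cast hm
  refine ⟨?_, by positivity, ?_, ?_⟩
  · rw [div_lt_iff₀ hg']; nlinarith [Real.pi_pos]
  · rw [μm]
    have : π / g + π / (2 * g) + m * π / g = (m + 3 / 2) * π / g := by field_simp; ring
    have h2 : (m + 3 / 2) * π / g ≤ π := by rw [div_le_iff₀ hg']; nlinarith [Real.pi_pos]
    linarith
  · rw [μm]
    have : (2 * m + 1) * π / g - m * π / g = (m + 1) * π / g := by field_simp; ring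
    have h2 : (m + 1) * π / g < π := by rw [div_lt_iff₀ hg']; nlinarith [Real.pi_pos]
    linarith

/-- Points of the fan are off the cut of the frame, with margin. [folklore] -/
theorem ang_sub_μm_mem_of_mem_fanW (hg : 2 ≤ g) {m : ℕ} (hm : m + 2 ≤ g) {u : 𝔼 2} (hu : u ∈ fanW g m) :
    ang (μm g m) u - μm g m ∈ Ioo (-π) π := by
  obtain ⟨h1, -, -, h4⟩ := fan_window hg hm
  have ha := hu.2
  have hμ : μm g m = -(m * π / g) := rfl
  have : π / g + m * π / g = (m + 1) * π / g := by ring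
  constructor
  · linarith [ha.1]
  · linarith [ha.2]

/-- The rotated angle is continuous at non-zero points of the fan. [folklore] -/
theorem continuousAt_ang_of_mem_fanW (hg : 2 ≤ g) {m : ℕ} (hm : m + 2 ≤ g) {u : 𝔼 2} (hu : u ∈ fanW g m) (hu0 : u ≠ 0) :
    ContinuousAt (ang (μm g m)) u :=
  continuousAt_ang hu0 (by have := (ang_sub_μm_mem_of_mem_fanW hg hm hu).2; intro h; rw [h] at this; linarith)

/-- The squeezed angle lies between the angle and `π/g` (`s ∈ [0, 1]`). [folklore] -/
theorem sqAng_mem {m : ℕ} {s : ℝ} (hs : s ∈ Icc (0 : ℝ) 1) {u : 𝔼 2} (hu : u ∈ fanW g m) :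
    ang (μm g m) u ≤ sqAng g m s u ∧ sqAng g m s u ≤ π / g := by
  have ha := hu.2.2
  rw [sqAng]; constructor <;> nlinarith [hs.1, hs.2]

/-- The squeezed angle stays in the fan window. [folklore] -/
theorem sqAng_window (hg : 2 ≤ g) {m : ℕ} (hm : m + 2 ≤ g) {s : ℝ} (hs : s ∈ Icc (0 : ℝ) 1) {u : 𝔼 2} (hu : u ∈ fanW g m) :
    sqAng g m s u ∈ Icc (-((2 * m + 1) * π / g)) (π / g) ∧ sqAng g m s u - μm g m ∈ Ioc (-π) π := by
  have h := sqAng_mem hs hu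
  have hw := ang_sub_μm_mem_of_mem_fanW hg hm hu
  obtain ⟨h1, -, -, -⟩ := fan_window hg hm
  refine ⟨⟨le_trans hu.2.1 h.1, h.2⟩, ⟨by linarith [hw.1], ?_⟩⟩
  rw [μm]
  have : π / g + m * π / g = (m + 1) * π / g := by field_simp; ring
  linarith [h.2]

/-- Far points (outside the small disc) of the collar region lie in the upper valley half-zone. [folklore] -/
theorem far_of_mem {m : ℕ} {u : 𝔼 2} (hU : u ∈ collarU g m) (hr : 1 / 4 ≤ ‖u‖) :
    u ≠ 0 ∧ π / (2 * g) < ang (μm g m) u := by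
  rcases hU with h | h
  · rw [mem_ball, dist_zero_right] at h; linarith
  · exact ⟨h.1, h.2.1⟩

/-- In the far part the squeezed angle lies in the valley zone. [folklore] -/
theorem sqAng_mem_zone (hg : 2 ≤ g) {m : ℕ} {s : ℝ} (hs : s ∈ Icc (0 : ℝ) 1) {u : 𝔼 2} (hu : u ∈ fanW g m)
    (hfar : π / (2 * g) < ang (μm g m) u) : sqAng g m s u ∈ Icc (π / (2 * g)) (3 * π / (2 * (g : ℝ))) := by
  have h := sqAng_mem hs hu
  have hz := valley_mem_Icc (g := g) (by omega)
  exact ⟨le_trans hfar.le h.1, le_trans h.2 hz.2⟩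

/-- Points of the domain have norm at most `ρ₄`. [folklore] -/
theorem norm_le_of_mem_fanW (hg : 2 ≤ g) {m : ℕ} {u : 𝔼 2} (hu : u ∈ fanW g m) : ‖u‖ ≤ rho4 hg := norm_le_rho4_of_flower_le hg hu.1

/-- **The key inequality in the far part**: the flower-preserving radius is at least the radius,
`‖u‖ ≤ R_s`. [folklore] -/
theorem norm_le_Rtot (hg : 2 ≤ g) {m : ℕ} {s : ℝ} (hs : s ∈ Icc (0 : ℝ) 1) {u : 𝔼 2} (hu : u ∈ fanW g m)
    (hfar : π / (2 * g) < ang (μm g m) u) : ‖u‖ ≤ Rtot hg (sqAng g m s u) (flower g u) := by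
  have hg1 : 1 ≤ g := by omega
  have hzone := sqAng_mem_zone hg hs hu hfar
  have hsq := sqAng_mem hs hu
  have h0 : 0 ≤ flower g u := flower_nonneg hg u
  have h1 : flower g u ≤ vmax hg (sqAng g m s u) := flower_le_vmax_of_le hg hu.1 _
  have hR := flower_pol_Rtot hg hzone h0 h1
  have hmono := strictMonoOn_flower_pol_of_cos_nonpos hg (cos_nonpos_of_mem hg1 hzone.1 hzone.2)
  -- `q(pol r θ_s) ≤ q(pol r θ) = q u = q(pol R θ_s)`
  have hpos : 0 < π / (2 * (g : ℝ)) := by positivity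
  have hle : flower g (pol ‖u‖ (sqAng g m s u)) ≤ flower g (pol ‖u‖ (ang (μm g m) u)) :=
    flower_pol_le_of_angle_le hg1 (norm_nonneg u) (by linarith) hsq.1 hsq.2
  rw [pol_norm_ang] at hle
  rw [← hR] at hle
  exact (hmono.le_iff_le (norm_nonneg u) (Rtot_mem hg _ _).1).1 hle

/-- The new radius lies between `‖u‖` and `R_s` (far part). [folklore] -/
theorem newRadius_mem (hg : 2 ≤ g) {m : ℕ} {s : ℝ} (hs : s ∈ Icc (0 : ℝ) 1) {u : 𝔼 2} (hu : u ∈ fanW g m)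
    (hfar : π / (2 * g) < ang (μm g m) u) :
    ‖u‖ ≤ ‖u‖ + lam ‖u‖ * (Rtot hg (sqAng g m s u) (flower g u) - ‖u‖) ∧
      ‖u‖ + lam ‖u‖ * (Rtot hg (sqAng g m s u) (flower g u) - ‖u‖) ≤ Rtot hg (sqAng g m s u) (flower g u) := by
  have hR := norm_le_Rtot hg hs hu hfar
  have hl := lam_mem ‖u‖
  constructor <;> nlinarith [hl.1, hl.2]

/-- Near the origin the deformation is the pure rotation. [folklore] -/
theorem fanψ_of_norm_le (hg : 2 ≤ g) {m : ℕ} {s : ℝ} {u : 𝔼 2} (hr : ‖u‖ ≤ 1 / 4) : fanψ hg m s u = pol ‖u‖ (sqAng g m s u) := by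
  rw [fanψ, lam_eq_zero hr, zero_mul, add_zero]

/-- The norm of the deformed point near the origin. [folklore] -/
theorem norm_fanψ_of_norm_le (hg : 2 ≤ g) {m : ℕ} {s : ℝ} {u : 𝔼 2} (hr : ‖u‖ ≤ 1 / 4) : ‖fanψ hg m s u‖ = ‖u‖ := by
  rw [fanψ_of_norm_le hg hr, norm_pol, abs_of_nonneg (norm_nonneg u)]

/-- **The deformation stays in the flower domain.** [folklore] -/
theorem flower_fanψ_le (hg : 2 ≤ g) {m : ℕ} {s : ℝ} (hs : s ∈ Icc (0 : ℝ) 1) {u : 𝔼 2} (hu : u ∈ fanW g m) (hU : u ∈ collarU g m) :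
    flower g (fanψ hg m s u) ≤ level g := by
  rcases le_or_gt ‖u‖ (1 / 4) with hr | hr
  · rw [fanψ_of_norm_le hg hr]
    exact le_trans (flower_pol_le_prof (norm_nonneg u) _) (prof_lt_level_of_le hg (norm_nonneg u) (by linarith)).le
  · obtain ⟨-, hfar⟩ := far_of_mem hU hr.le
    have hzone := sqAng_mem_zone hg hs hu hfar
    have hmono := (strictMonoOn_flower_pol_of_cos_nonpos hg (cos_nonpos_of_mem (by omega) hzone.1 hzone.2)).monotoneOn
    have hnew := newRadius_mem hg hs hu hfar
    have hR := flower_pol_Rtot hg hzone (flower_nonneg hg u) (flower_le_vmax_of_le hg hu.1 _)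
    rw [fanψ]
    calc flower g (pol (‖u‖ + lam ‖u‖ * (Rtot hg (sqAng g m s u) (flower g u) - ‖u‖)) (sqAng g m s u))
        ≤ flower g (pol (Rtot hg (sqAng g m s u) (flower g u)) (sqAng g m s u)) :=
          hmono (le_trans (norm_nonneg u) hnew.1 : _ ∈ Ici (0:ℝ)) ((Rtot_mem hg _ _).1 : _ ∈ Ici (0:ℝ)) hnew.2
      _ = flower g u := hR
      _ ≤ level g := hu.1

/-- The new radius is non-negative. [folklore] -/
theorem newRadius_nonneg (hg : 2 ≤ g) {m : ℕ} {s : ℝ} (hs : s ∈ Icc (0 : ℝ) 1) {u : 𝔼 2} (hu : u ∈ fanW g m) (hU : u ∈ collarU g m) :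
    0 ≤ ‖u‖ + lam ‖u‖ * (Rtot hg (sqAng g m s u) (flower g u) - ‖u‖) := by
  rcases le_or_gt ‖u‖ (1 / 4) with hr | hr
  · rw [lam_eq_zero hr, zero_mul, add_zero]; exact norm_nonneg u
  · obtain ⟨-, hfar⟩ := far_of_mem hU hr.le
    exact le_trans (norm_nonneg u) (newRadius_mem hg hs hu hfar).1

/-- The rotated angle of the deformed point (when it is not the origin). [folklore] -/
theorem ang_fanψ (hg : 2 ≤ g) {m : ℕ} (hm : m + 2 ≤ g) {s : ℝ} (hs : s ∈ Icc (0 : ℝ) 1) {u : 𝔼 2} (hu : u ∈ fanW g m)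
    (hpos : 0 < ‖u‖ + lam ‖u‖ * (Rtot hg (sqAng g m s u) (flower g u) - ‖u‖)) :
    ang (μm g m) (fanψ hg m s u) = sqAng g m s u := by
  rw [fanψ]; exact ang_pol hpos (sqAng_window hg hm hs hu).2

/-- **The deformation maps the collar region of the fan into itself.** [folklore] -/
theorem fanψ_mem (hg : 2 ≤ g) {m : ℕ} (hm : m + 2 ≤ g) {s : ℝ} (hs : s ∈ Icc (0 : ℝ) 1) {u : 𝔼 2} (hu : u ∈ fanW g m) (hU : u ∈ collarU g m) :
    fanψ hg m s u ∈ fanW g m ∩ collarU g m := by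
  have hq := flower_fanψ_le hg hs hu hU
  have hr0 := newRadius_nonneg hg hs hu hU
  have hwin := sqAng_window hg hm hs hu
  -- the angle of the new point
  have hang : ang (μm g m) (fanψ hg m s u) ∈ Icc (-((2 * m + 1) * π / g)) (π / g) := by
    rcases hr0.eq_or_lt with h0 | h0
    · have : fanψ hg m s u = 0 := by rw [fanψ, ← h0, pol_zero_left]
      rw [this, ang_zero]
      have hμ : μm g m = -(m * π / g) := rfl
      have hpos1 : 0 ≤ m * π / g := by positivity
      have hpos2 : 0 ≤ π / g := by positivity
      have hle : m * π / g ≤ (2 * m + 1) * π / g :=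
        div_le_div_of_nonneg_right (by nlinarith [Real.pi_pos]) (by positivity)
      exact ⟨by linarith, by linarith⟩
    · rw [ang_fanψ hg hm hs hu h0]; exact hwin.1
  refine ⟨⟨hq, hang⟩, ?_⟩
  -- membership in the collar region
  rcases le_or_gt ‖u‖ (1 / 4) with hr | hr
  · by_cases hfar : u ≠ 0 ∧ π / (2 * g) < ang (μm g m) u
    · right
      have hpos : 0 < ‖u‖ + lam ‖u‖ * (Rtot hg (sqAng g m s u) (flower g u) - ‖u‖) := by
        rw [lam_eq_zero hr, zero_mul, add_zero]; exact norm_pos_iff.2 hfar.1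
      refine ⟨?_, ?_, ?_⟩
      · intro h0
        have := congrArg (fun v : 𝔼 2 => ‖v‖) h0
        simp only [norm_zero] at this
        rw [fanψ, norm_pol, abs_of_pos hpos] at this
        linarith
      · rw [ang_fanψ hg hm hs hu hpos]
        exact lt_of_lt_of_le hfar.2 (sqAng_mem hs hu).1
      · rw [ang_fanψ hg hm hs hu hpos]
        obtain ⟨-, h2, -, -⟩ := fan_window hg hm
        linarith [(sqAng_mem hs hu).2]
    · left
      rw [mem_ball, dist_zero_right, norm_fanψ_of_norm_le hg hr]
      rcases hU with h | h
      · rw [mem_ball, dist_zero_right] at h; exact h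
      · exact absurd ⟨h.1, h.2.1⟩ hfar
  · obtain ⟨hu0, hfar⟩ := far_of_mem hU hr.le
    right
    have hnew := newRadius_mem hg hs hu hfar
    have hpos : 0 < ‖u‖ + lam ‖u‖ * (Rtot hg (sqAng g m s u) (flower g u) - ‖u‖) :=
      lt_of_lt_of_le (by linarith) hnew.1
    refine ⟨?_, ?_, ?_⟩
    · intro h0
      have := congrArg (fun v : 𝔼 2 => ‖v‖) h0
      simp only [norm_zero] at this
      rw [fanψ, norm_pol, abs_of_pos hpos] at this
      linarith
    · rw [ang_fanψ hg hm hs hu hpos]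
      exact lt_of_lt_of_le hfar (sqAng_mem hs hu).1
    · rw [ang_fanψ hg hm hs hu hpos]
      obtain ⟨-, h2, -, -⟩ := fan_window hg hm
      linarith [(sqAng_mem hs hu).2]

/-- **Seam points go to seam points.** [folklore] -/
theorem flower_fanψ_eq (hg : 2 ≤ g) {m : ℕ} {s : ℝ} (hs : s ∈ Icc (0 : ℝ) 1) {u : 𝔼 2} (hu : u ∈ fanW g m) (hU : u ∈ collarU g m)
    (hseam : flower g u = level g) : flower g (fanψ hg m s u) = level g := by
  -- seam points have norm `≥ ρ₁ > 1/2`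
  have hbig : 1 / 2 ≤ ‖u‖ := by
    have h1 : level g ≤ prof g ‖u‖ := by
      have := flower_pol_le_prof (g := g) (norm_nonneg u) (ang (μm g m) u)
      rw [pol_norm_ang, hseam] at this; exact this
    rcases (level_le_prof_iff hg (norm_nonneg u)).1 h1 with h | h
    · linarith [h.1, (rho1_mem hg).1]
    · linarith [rt_seven_lt_rho3 hg, one_le_rt (g := g) (by norm_num : (1:ℝ) ≤ 7)]
  obtain ⟨-, hfar⟩ := far_of_mem hU (by linarith)
  have hzone := sqAng_mem_zone hg hs hu hfar
  rw [fanψ, lam_eq_one hbig, one_mul, add_sub_cancel,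
    flower_pol_Rtot hg hzone (flower_nonneg hg u) (flower_le_vmax_of_le hg hu.1 _), hseam]

/-- **At time `0` the deformation is the identity.** [folklore] -/
theorem fanψ_zero (hg : 2 ≤ g) {m : ℕ} {u : 𝔼 2} (hu : u ∈ fanW g m) (hU : u ∈ collarU g m) : fanψ hg m 0 u = u := by
  have h0 : sqAng g m 0 u = ang (μm g m) u := by rw [sqAng]; ring
  rcases le_or_gt ‖u‖ (1 / 4) with hr | hr
  · rw [fanψ_of_norm_le hg hr, h0, pol_norm_ang]
  · obtain ⟨-, hfar⟩ := far_of_mem hU hr.le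
    have hzone : ang (μm g m) u ∈ Icc (π / (2 * g)) (3 * π / (2 * (g : ℝ))) := by
      have := sqAng_mem_zone hg (⟨le_rfl, zero_le_one⟩ : (0:ℝ) ∈ Icc 0 1) hu hfar
      rwa [h0] at this
    have hR : Rtot hg (ang (μm g m) u) (flower g u) = ‖u‖ :=
      Rtot_eq hg hzone (flower_nonneg hg u) (flower_le_vmax_of_le hg hu.1 _) (norm_nonneg u)
        (by rw [pol_norm_ang])
    rw [fanψ, h0, hR, sub_self, mul_zero, add_zero, pol_norm_ang]

/-- **At time `1` the deformation lands on the valley ray segment.** [folklore] -/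
theorem fanψ_one_mem (hg : 2 ≤ g) {m : ℕ} {u : 𝔼 2} (hu : u ∈ fanW g m) (hU : u ∈ collarU g m) : fanψ hg m 1 u ∈ vRay g hg := by
  have h1 : sqAng g m 1 u = π / g := by rw [sqAng]; ring
  have hs : (1 : ℝ) ∈ Icc (0 : ℝ) 1 := ⟨zero_le_one, le_rfl⟩
  have hr0 := newRadius_nonneg hg hs hu hU
  refine ⟨_, ⟨hr0, ?_⟩, by rw [fanψ, h1]⟩
  rcases le_or_gt ‖u‖ (1 / 4) with hr | hr
  · rw [lam_eq_zero hr, zero_mul, add_zero]; exact norm_le_of_mem_fanW hg hu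
  · obtain ⟨-, hfar⟩ := far_of_mem hU hr.le
    exact le_trans (newRadius_mem hg hs hu hfar).2 (Rtot_mem hg _ _).2

/-- The valley ray segment lies in the fan and in the collar region. [folklore] -/
theorem vRay_subset (hg : 2 ≤ g) {m : ℕ} (hm : m + 2 ≤ g) : vRay g hg ⊆ fanW g m ∩ collarU g m := by
  rintro _ ⟨r, ⟨hr0, hr4⟩, rfl⟩
  have hg1 : 1 ≤ g := by omega
  obtain ⟨h1, h2, h3, h4⟩ := fan_window hg hm
  have hq : flower g (pol r (π / g)) ≤ level g := by
    rw [flower_pol_valley hg1]; exact (vprof_le_level_iff hg hr0).2 hr4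
  have hwin : π / g - μm g m ∈ Ioc (-π) π := by
    rw [μm]
    have : π / g - -(m * π / g) = (m + 1) * π / g := by field_simp; ring
    rw [this]; exact ⟨by linarith [show 0 < (m + 1) * π / g by positivity], h1.le⟩
  have hg' : (0 : ℝ) < g := by exact_mod_cast (show 0 < g by omega)
  have hhalf : π / (2 * g) < π / g := div_lt_div_of_pos_left Real.pi_pos hg' (by linarith)
  show pol r (π / g) ∈ fanW g m ∩ collarU g m
  rcases hr0.eq_or_lt with h0 | h0
  · subst h0
    rw [pol_zero_left]
    refine ⟨⟨by rw [flower_zero hg1]; exact (level_pos hg1).le, ?_⟩, Or.inl (mem_ball_self (by norm_num))⟩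
    rw [ang_zero]
    have hμ : μm g m = -(m * π / g) := rfl
    have hpos1 : 0 ≤ m * π / g := by positivity
    have hpos2 : 0 ≤ π / g := by positivity
    have hle : m * π / g ≤ (2 * m + 1) * π / g :=
      div_le_div_of_nonneg_right (by nlinarith [Real.pi_pos]) (by positivity)
    exact ⟨by linarith, by linarith⟩
  · have hang : ang (μm g m) (pol r (π / g)) = π / g := ang_pol h0 hwin
    refine ⟨⟨hq, ?_⟩, ?_⟩
    · rw [hang]; exact ⟨by linarith [show 0 < π / g by positivity, show 0 ≤ (2 * m + 1) * π / g by positivity], le_rfl⟩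
    · rcases lt_or_ge r (1 / 4) with hsmall | hbig
      · exact Or.inl (by rw [mem_ball, dist_zero_right, norm_pol, abs_of_pos h0]; exact hsmall)
      · right
        refine ⟨fun h => ?_, ?_, ?_⟩
        · have := congrArg (fun v : 𝔼 2 => ‖v‖) h
          simp only [norm_pol, norm_zero, abs_of_pos h0] at this
          linarith
        · rw [hang]; exact hhalf
        · rw [hang]; linarith

/-- **The deformation fixes the valley ray segment.** [folklore] -/
theorem fanψ_eq_self_of_mem_vRay (hg : 2 ≤ g) {m : ℕ} (hm : m + 2 ≤ g) (s : ℝ) {u : 𝔼 2} (hu : u ∈ vRay g hg) :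
    fanψ hg m s u = u := by
  obtain ⟨r, ⟨hr0, hr4⟩, rfl⟩ := hu
  have hg1 : 1 ≤ g := by omega
  obtain ⟨h1, -, -, -⟩ := fan_window hg hm
  show fanψ hg m s (pol r (π / g)) = pol r (π / g)
  rcases hr0.eq_or_lt with h0 | h0
  · subst h0
    rw [pol_zero_left, fanψ, norm_zero, lam_eq_zero (by norm_num), zero_mul, add_zero, pol_zero_left]
  · have hwin : π / g - μm g m ∈ Ioc (-π) π := by
      rw [μm]
      have : π / g - -(m * π / g) = (m + 1) * π / g := by field_simp; ring
      rw [this]; exact ⟨by linarith [show 0 < (m + 1) * π / g by positivity], h1.le⟩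
    have hang : ang (μm g m) (pol r (π / g)) = π / g := ang_pol h0 hwin
    have hθ : sqAng g m s (pol r (π / g)) = π / g := by rw [sqAng, hang]; ring
    have hR : Rtot hg (π / g) (flower g (pol r (π / g))) = ‖pol r (π / g)‖ := by
      rw [norm_pol, abs_of_pos h0]
      exact Rtot_eq hg (valley_mem_Icc hg1) (flower_nonneg hg _)
        (flower_le_vmax_of_le hg ((vRay_subset hg hm ⟨r, ⟨hr0, hr4⟩, rfl⟩).1.1) _) h0.le rfl
    rw [fanψ, hθ, hR, sub_self, mul_zero, add_zero, norm_pol, abs_of_pos h0]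

/-- **Continuity of the fan collar deformation** on `ℝ × (fan ∩ collar region)`. [folklore] -/
theorem continuousOn_fanψ (hg : 2 ≤ g) {m : ℕ} (hm : m + 2 ≤ g) : ContinuousOn (fun x : ℝ × 𝔼 2 => fanψ hg m x.1 x.2) ((univ : Set ℝ) ×ˢ (fanW g m ∩ collarU g m)) := by
  rintro ⟨t, u⟩ ⟨-, hu, hU⟩
  by_cases hu0 : u = 0
  · -- at the origin: `‖ψ‖ = ‖u‖ → 0` near the origin
    subst hu0
    have hval : fanψ hg m t 0 = 0 := by
      rw [fanψ, norm_zero, lam_eq_zero (by norm_num), zero_mul, add_zero, pol_zero_left]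
    rw [ContinuousWithinAt, hval]
    -- eventually (near the origin) `‖ψ x‖ = ‖x.2‖`
    have hsmall : ∀ᶠ x : ℝ × 𝔼 2 in 𝓝[(univ : Set ℝ) ×ˢ (fanW g m ∩ collarU g m)] (t, 0), ‖x.2‖ < 1 / 4 := by
      have : ∀ᶠ x : ℝ × 𝔼 2 in 𝓝 (t, (0 : 𝔼 2)), ‖x.2‖ < 1 / 4 := by
        have hc : Continuous fun x : ℝ × 𝔼 2 => ‖x.2‖ := continuous_norm.comp continuous_snd
        exact hc.continuousAt.eventually (gt_mem_nhds (by simp))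
      exact this.filter_mono nhdsWithin_le_nhds
    have hbound : ∀ᶠ x : ℝ × 𝔼 2 in 𝓝[(univ : Set ℝ) ×ˢ (fanW g m ∩ collarU g m)] (t, 0),
        ‖fanψ hg m x.1 x.2‖ ≤ ‖x.2‖ :=
      hsmall.mono fun x hx => le_of_eq (norm_fanψ_of_norm_le hg hx.le)
    have hlim : Tendsto (fun x : ℝ × 𝔼 2 => ‖x.2‖) (𝓝[(univ : Set ℝ) ×ˢ (fanW g m ∩ collarU g m)] (t, 0)) (𝓝 0) := by
      have : Tendsto (fun x : ℝ × 𝔼 2 => ‖x.2‖) (𝓝 ((t, (0 : 𝔼 2)))) (𝓝 0) :=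
        (continuous_norm.comp continuous_snd).tendsto' (t, (0 : 𝔼 2)) 0 (by simp)
      exact this.mono_left nhdsWithin_le_nhds
    exact squeeze_zero_norm' hbound hlim
  · -- away from the origin every ingredient is continuous
    have hang : ContinuousAt (fun x : ℝ × 𝔼 2 => ang (μm g m) x.2) (t, u) :=
      (continuousAt_ang_of_mem_fanW hg hm hu hu0).comp_of_eq continuous_snd.continuousAt rfl
    have hθ : ContinuousAt (fun x : ℝ × 𝔼 2 => sqAng g m x.1 x.2) (t, u) := by
      unfold sqAng
      have h3 : ContinuousAt (fun x : ℝ × 𝔼 2 => x.1) (t, u) := continuous_fst.continuousAt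
      exact hang.add (h3.mul (continuousAt_const.sub hang))
    have hq : ContinuousAt (fun x : ℝ × 𝔼 2 => flower g x.2) (t, u) :=
      (contDiff_flower.continuous.comp continuous_snd).continuousAt
    have hR : ContinuousAt (fun x : ℝ × 𝔼 2 => Rtot hg (sqAng g m x.1 x.2) (flower g x.2)) (t, u) :=
      (continuous_Rtot hg).continuousAt.comp_of_eq (hθ.prodMk hq) rfl
    have hr : ContinuousAt (fun x : ℝ × 𝔼 2 => ‖x.2‖) (t, u) := by fun_prop
    have hl : ContinuousAt (fun x : ℝ × 𝔼 2 => lam ‖x.2‖) (t, u) := continuous_lam.continuousAt.comp_of_eq hr rfl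
    have hrad : ContinuousAt (fun x : ℝ × 𝔼 2 =>
        ‖x.2‖ + lam ‖x.2‖ * (Rtot hg (sqAng g m x.1 x.2) (flower g x.2) - ‖x.2‖)) (t, u) :=
      hr.add (hl.mul (hR.sub hr))
    have hcomp := (continuous_pol.continuousAt).comp (hrad.prodMk hθ)
    exact hcomp.continuousWithinAt

/-- **The collar of the standard valley arc in the fan**: over the open collar region the flower
surface over the fan strong deformation retracts onto the valley arc. [folklore] -/
theorem isStrongDeformationRetractOf_vArcSet_fan (hg : 2 ≤ g) {m : ℕ} (hm : m + 2 ≤ g) :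
    IsStrongDeformationRetractOf (vArcSet g hg)
      ({p | thicken (flower g) p = level g} ∩ proj ⁻¹' (fanW g m ∩ collarU g m)) := by
  have h := isStrongDeformationRetractOf_double' (q := flower g) (c := level g) contDiff_flower.continuous
    (W := fanW g m ∩ collarU g m) (K := vRay g hg) (fanψ hg m)
    ((continuousOn_fanψ hg hm).mono (prod_mono (subset_univ _) le_rfl))
    (fun s hs u hu => fanψ_mem hg hm hs hu.1 hu.2) (fun u hu => hu.1.1)
    (fun s hs u hu hq => flower_fanψ_eq hg hs hu.1 hu.2 hq) (fun u hu => fanψ_zero hg hu.1 hu.2)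
    (fun u hu => fanψ_one_mem hg hu.1 hu.2)
    (fun s _ u _ huK => fanψ_eq_self_of_mem_vRay hg hm s huK)
  exact h


/-- **The collar region is open.** [folklore] -/
theorem isOpen_collarU (hg : 2 ≤ g) {m : ℕ} (hm : m + 2 ≤ g) : IsOpen (collarU g m) := by
  obtain ⟨-, -, h3, -⟩ := fan_window hg hm
  refine isOpen_ball.union ?_
  rw [isOpen_iff_mem_nhds]
  rintro u ⟨hu0, ha, hb⟩
  have hcut : ang (μm g m) u ≠ μm g m + π := by intro h; rw [h] at hb; linarith
  have hc : ContinuousAt (ang (μm g m)) u := continuousAt_ang hu0 hcut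
  have h1 : {v : 𝔼 2 | v ≠ 0} ∈ 𝓝 u := isOpen_ne.mem_nhds hu0
  have h2 : ang (μm g m) ⁻¹' Ioo (π / (2 * g)) (π / g + π / (2 * g)) ∈ 𝓝 u :=
    hc.preimage_mem_nhds (isOpen_Ioo.mem_nhds ⟨ha, hb⟩)
  filter_upwards [h1, h2] with v hv1 hv2
  exact ⟨hv1, hv2.1, hv2.2⟩

/-- The lifted collar region `π⁻¹(collar region)` is open in `ℝ³`. [folklore] -/
theorem isOpen_preimage_collarU (hg : 2 ≤ g) {m : ℕ} (hm : m + 2 ≤ g) :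
    IsOpen (proj ⁻¹' collarU g m : Set (𝔼 3)) :=
  (isOpen_collarU hg hm).preimage proj.continuous

/-- The valley arc lies in the collar: `vArcSet ⊆ Z ∩ π⁻¹(fan ∩ collar region)`. [folklore] -/
theorem vArcSet_subset_collar (hg : 2 ≤ g) {m : ℕ} (hm : m + 2 ≤ g) :
    vArcSet g hg ⊆ {p | thicken (flower g) p = level g} ∩ proj ⁻¹' (fanW g m ∩ collarU g m) := by
  rintro p ⟨hq, hray⟩
  exact ⟨hq, vRay_subset hg hm hray⟩


/-! ### §5 Angular cones -/

/-- **The closed angular cone** between the angles `a ≤ b` (`b ≤ a + π`): the intersection of two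
closed half-planes, hence convex; it contains the origin. [folklore] -/
def cone (a b : ℝ) : Set (𝔼 2) :=
  {v | 0 ≤ (toC v * Complex.exp (-(a * I))).im ∧ (toC v * Complex.exp (-(b * I))).im ≤ 0}

/-- The imaginary part of the rotated coordinate of a polar point: `r sin(θ - a)`. [folklore] -/
theorem im_toC_mul_exp_pol (a r θ : ℝ) : (toC (pol r θ) * Complex.exp (-(a * I))).im = r * Real.sin (θ - a) := by
  rw [toC_mul_exp_pol, Complex.mul_im, Complex.ofReal_re, Complex.ofReal_im, zero_mul, add_zero,
    Complex.exp_ofReal_mul_I_im]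

/-- The defining functionals of the cone are linear. [folklore] -/
theorem isLinearMap_im_toC_mul (c : ℂ) : IsLinearMap ℝ fun v : 𝔼 2 => (toC v * c).im :=
  { map_add := fun x y => by rw [map_add, add_mul, Complex.add_im]
    map_smul := fun t x => by
      rw [LinearIsometryEquiv.map_smul, Complex.real_smul, mul_assoc, Complex.mul_im, Complex.ofReal_re,
        Complex.ofReal_im, zero_mul, add_zero]
      rfl }

/-- The cone is convex. [folklore] -/
theorem convex_cone (a b : ℝ) : Convex ℝ (cone a b) :=
  (convex_halfSpace_ge (isLinearMap_im_toC_mul (Complex.exp (-(a * I)))) 0).inter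
    (convex_halfSpace_le (isLinearMap_im_toC_mul (Complex.exp (-(b * I)))) 0)

/-- Polar points with angle in `[a, b]`, `b ≤ a + π`, non-negative radius, lie in the cone. [folklore] -/
theorem pol_mem_cone {a b r θ : ℝ} (hr : 0 ≤ r) (ha : a ≤ θ) (hb : θ ≤ b) (hab : b ≤ a + π) : pol r θ ∈ cone a b := by
  refine ⟨?_, ?_⟩
  · rw [im_toC_mul_exp_pol]
    exact mul_nonneg hr (Real.sin_nonneg_of_nonneg_of_le_pi (by linarith) (by linarith))
  · rw [im_toC_mul_exp_pol]
    have : Real.sin (θ - b) ≤ 0 := Real.sin_nonpos_of_nonpos_of_neg_pi_le (by linarith) (by linarith)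
    nlinarith

/-- The origin lies in every cone. [folklore] -/
theorem zero_mem_cone (a b : ℝ) : (0 : 𝔼 2) ∈ cone a b := by simp [cone]

/-- **The angle of a non-zero cone point** lies in `[a, b]`, for `a < b` inside a frame
`(μ - π, μ + π]`. [folklore] -/
theorem ang_mem_of_mem_cone {a b μ : ℝ} (hab : a < b) (ha : μ - π < a) (hb : b ≤ μ + π)
    {v : 𝔼 2} (hv : v ∈ cone a b) (hv0 : v ≠ 0) : ang μ v ∈ Icc a b := by
  have hr : 0 < ‖v‖ := norm_pos_iff.2 hv0
  have hw := ang_mem μ v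
  obtain ⟨h1, h2⟩ := hv
  rw [← pol_norm_ang μ v, im_toC_mul_exp_pol] at h1 h2
  have hs1 : 0 ≤ Real.sin (ang μ v - a) := (mul_nonneg_iff_of_pos_left hr).1 h1
  have hs2 : Real.sin (ang μ v - b) ≤ 0 := by
    by_contra h; push Not at h; nlinarith [mul_pos hr h]
  constructor
  · by_contra hlt
    push Not at hlt
    have hneg : ang μ v - a < 0 := by linarith
    have hle : ang μ v - a ≤ -π := by
      by_contra h; push Not at h
      have := Real.sin_neg_of_neg_of_neg_pi_lt hneg h
      linarith
    have hb1 : ang μ v - b < -π := by linarith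
    have hb2 : -(2 * π) < ang μ v - b := by linarith [hw.1]
    have : 0 < Real.sin (ang μ v - b) := by
      have := Real.sin_pos_of_pos_of_lt_pi (x := ang μ v - b + 2 * π) (by linarith) (by linarith)
      rwa [Real.sin_add_two_pi] at this
    linarith
  · by_contra hlt
    push Not at hlt
    have hpos : 0 < ang μ v - b := by linarith
    have hge : π ≤ ang μ v - b := by
      by_contra h; push Not at h
      have := Real.sin_pos_of_pos_of_lt_pi hpos h
      linarith
    have ha1 : π < ang μ v - a := by linarith
    have ha2 : ang μ v - a < 2 * π := by linarith [hw.2]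
    have : Real.sin (ang μ v - a) < 0 := by
      have := Real.sin_neg_of_neg_of_neg_pi_lt (x := ang μ v - a - 2 * π) (by linarith) (by linarith)
      rwa [Real.sin_sub_two_pi] at this
    linarith

/-! ### §6 The two-edged fan and its collar deformation -/

/-- The bisector angle `μ_k = (k+1)π/g` of the fan `S₁ ∪ … ∪ S_k` (angles `[π/g, (2k+1)π/g]`). [folklore] -/
def μk (g k : ℕ) : ℝ := (k + 1) * π / g

variable (g) in
/-- **The two-edged fan** `S₁ ∪ … ∪ S_k`: the points of the domain with angle in `[π/g, (2k+1)π/g]`. [folklore] -/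
def fanF (k : ℕ) : Set (𝔼 2) :=
  {u | flower g u ≤ level g ∧ ang (μk g k) u ∈ Icc (π / g) ((2 * k + 1) * π / g)}

variable (g) in
/-- The lower half of the two-edged fan: angles in `[π/g, μ_k]`. [folklore] -/
def fanFlo (k : ℕ) : Set (𝔼 2) := {u | flower g u ≤ level g ∧ ang (μk g k) u ∈ Icc (π / g) (μk g k)}

variable (g) in
/-- **The two-edged collar region**: a small disc about the origin together with the two inner
valley half-zones along the edges. [folklore] -/
def collarU2 (k : ℕ) : Set (𝔼 2) :=
  ball 0 (1 / 8) ∪ {u | u ≠ 0 ∧ π / g - π / (2 * g) < ang (μk g k) u ∧ ang (μk g k) u < π / g + π / (2 * g)} ∪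
    {u | u ≠ 0 ∧ (2 * k + 1) * π / g - π / (2 * g) < ang (μk g k) u ∧ ang (μk g k) u < (2 * k + 1) * π / g + π / (2 * g)}

/-- The blend weight `λ₂(r)`: `0` for `r ≤ 1/8`, `1` for `r ≥ 1/4`. [folklore] -/
def lam2 (r : ℝ) : ℝ := max 0 (min 1 (8 * r - 1))

/-- `λ₂` is continuous. [folklore] -/
theorem continuous_lam2 : Continuous lam2 := by unfold lam2; fun_prop

/-- `0 ≤ λ₂ ≤ 1`. [folklore] -/
theorem lam2_mem (r : ℝ) : lam2 r ∈ Icc (0 : ℝ) 1 := ⟨le_max_left _ _, max_le zero_le_one (min_le_left _ _)⟩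

/-- `λ₂ = 0` on `[0, 1/8]`. [folklore] -/
theorem lam2_eq_zero {r : ℝ} (hr : r ≤ 1 / 8) : lam2 r = 0 := by
  rw [lam2, max_eq_left]; exact min_le_of_right_le (by linarith)

/-- `λ₂ = 1` on `[1/4, ∞)`. [folklore] -/
theorem lam2_eq_one {r : ℝ} (hr : 1 / 4 ≤ r) : lam2 r = 1 := by
  rw [lam2, min_eq_left (by linarith), max_eq_right zero_le_one]

/-- The squeezed angle towards the lower edge: `θ_s = θ - s(θ - π/g)`. [folklore] -/
def sqAng2 (g k : ℕ) (s : ℝ) (u : 𝔼 2) : ℝ := ang (μk g k) u - s * (ang (μk g k) u - π / g)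

/-- **The fold** towards the lower edge: radius scaled by the angular distance from the bisector. [folklore] -/
def fold (g k : ℕ) (u : 𝔼 2) : 𝔼 2 :=
  pol (‖u‖ * ((μk g k - ang (μk g k) u) / (μk g k - π / g))) (π / g)

/-- The flower-preserving squeeze point towards the lower edge. [folklore] -/
def farPt (hg : 2 ≤ g) (k : ℕ) (s : ℝ) (u : 𝔼 2) : 𝔼 2 :=
  pol (Rtot hg (sqAng2 g k s u) (flower g u)) (sqAng2 g k s u)

/-- **The lower-half deformation of the two-edged fan**: straight-line fold near the origin,
flower-preserving squeeze far from it, blended by `λ₂(‖u‖)`. [folklore] -/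
def loΦ (hg : 2 ≤ g) (k : ℕ) (s : ℝ) (u : 𝔼 2) : 𝔼 2 :=
  (1 - lam2 ‖u‖) • ((1 - s) • u + s • fold g k u) + lam2 ‖u‖ • farPt hg k s u


/-- `pol` is linear in the radius. [folklore] -/
theorem pol_eq_smul (r θ : ℝ) : pol r θ = r • pol 1 θ := by
  apply toC.injective
  rw [LinearIsometryEquiv.map_smul, toC_pol, toC_pol, Complex.real_smul]; push_cast; ring

/-- Convex combinations of points of a ray segment lie on the ray segment. [folklore] -/
theorem combo_pol_mem_vRay (hg : 2 ≤ g) {a b t : ℝ} (ha : a ∈ Icc 0 (rho4 hg)) (hb : b ∈ Icc 0 (rho4 hg))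
    (ht : t ∈ Icc (0 : ℝ) 1) : (1 - t) • pol a (π / g) + t • pol b (π / g) ∈ vRay g hg := by
  refine ⟨(1 - t) * a + t * b, ⟨by nlinarith [ha.1, hb.1, ht.1, ht.2], by nlinarith [ha.2, hb.2, ht.1, ht.2]⟩, ?_⟩
  show pol ((1 - t) * a + t * b) (π / g) = _
  rw [pol_eq_smul, pol_eq_smul a, pol_eq_smul b, smul_smul, smul_smul, ← add_smul]

/-- **For fixed radius the flower increases with the angle on `[π/g, 2π/g]`** (the mirror image
of §3 under `θ ↦ 2π/g - θ`). [folklore] -/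
theorem flower_pol_le_of_angle_le' (hg : 1 ≤ g) {r : ℝ} (hr : 0 ≤ r) {θ θ' : ℝ} (h0 : π / g ≤ θ') (hle : θ' ≤ θ)
    (h1 : θ ≤ 2 * π / g) : flower g (pol r θ') ≤ flower g (pol r θ) := by
  have hg' : (g : ℝ) ≠ 0 := by exact_mod_cast (show g ≠ 0 by omega)
  have key : ∀ φ : ℝ, flower g (pol r φ) = flower g (pol r (2 * π / g - φ)) := fun φ => by
    rw [flower_pol, flower_pol]
    congr 2
    rw [show (g : ℝ) * (2 * π / g - φ) = 2 * π - g * φ by field_simp, Real.cos_two_pi_sub]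
  rw [key θ', key θ]
  exact flower_pol_le_of_angle_le hg hr (by linarith) (by linarith) (by
    have : 2 * π / g - π / g = π / g := by ring
    linarith)

section TwoRay

/-- Numerology of the two-edged fan (`1 ≤ k`, `k + 1 ≤ g`): `0 < w = kπ/g < π` etc. [folklore] -/
theorem fan2_window (hg : 2 ≤ g) {k : ℕ} (hk : 1 ≤ k) (hkg : k + 1 ≤ g) :
    0 < π / (2 * (g : ℝ)) ∧ π / g ≤ μk g k - π / (2 * g) ∧ μk g k - π / g < π ∧ μk g k - π < π / g - π / (2 * g) ∧
      (2 * k + 1) * π / g + π / (2 * g) ≤ μk g k + π ∧ (2 * k + 1) * π / g = 2 * μk g k - π / g ∧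
      π / g + π / (2 * g) ≤ 3 * π / (2 * g) ∧ π / g + π / (2 * g) ≤ μk g k := by
  have hg' : (0 : ℝ) < g := by exact_mod_cast (show 0 < g by omega)
  have hk' : (1 : ℝ) ≤ k := by exact_mod_cast hk
  have hkg' : (k : ℝ) + 1 ≤ g := by exact_mod_cast hkg
  have hμ : μk g k = (k + 1) * π / g := rfl
  have e1 : π / (2 * (g : ℝ)) = (1 / 2) * (π / g) := by field_simp
  have hpg : 0 < π / g := by positivity
  have hπg : π / g * g = π := by field_simp
  refine ⟨by positivity, ?_, ?_, ?_, ?_, ?_, ?_, ?_⟩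
  · rw [hμ, e1]
    have : (k + 1) * π / g = (k + 1) * (π / g) := by ring
    rw [this]; nlinarith
  · rw [hμ]
    have : (k + 1) * π / g - π / g = k * (π / g) := by ring
    rw [this]
    calc (k : ℝ) * (π / g) < g * (π / g) := by apply mul_lt_mul_of_pos_right _ hpg; linarith
      _ = π := by field_simp
  · rw [hμ, e1]
    have : (k + 1) * π / g = (k + 1) * (π / g) := by ring
    rw [this]
    have h2 : (k : ℝ) * (π / g) + (1 / 2) * (π / g) < g * (π / g) := by
      rw [← add_mul]; apply mul_lt_mul_of_pos_right _ hpg; linarith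
    have : (g : ℝ) * (π / g) = π := by field_simp
    linarith
  · rw [hμ, e1]
    have e2 : (2 * k + 1) * π / g = (2 * k + 1) * (π / g) := by ring
    have e3 : (k + 1) * π / g = (k + 1) * (π / g) := by ring
    rw [e2, e3]
    have h2 : (k : ℝ) * (π / g) + (1 / 2) * (π / g) ≤ g * (π / g) := by
      rw [← add_mul]; apply mul_le_mul_of_nonneg_right _ hpg.le; linarith
    have : (g : ℝ) * (π / g) = π := by field_simp
    nlinarith
  · rw [hμ]; ring
  · have e3 : 3 * π / (2 * (g : ℝ)) = (3 / 2) * (π / g) := by field_simp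
    rw [e1, e3]; nlinarith
  · rw [hμ, e1]
    have : (k + 1) * π / g = (k + 1) * (π / g) := by ring
    rw [this]; nlinarith

variable (hg : 2 ≤ g) {k : ℕ} (hk : 1 ≤ k) (hkg : k + 1 ≤ g)
include hg hk hkg

/-- Points of the two-edged fan are off the cut of the frame, with margin. [folklore] -/
theorem ang_window_of_mem_fanF {u : 𝔼 2} (hu : u ∈ fanF g k) : ang (μk g k) u - μk g k ∈ Ioo (-π) π := by
  obtain ⟨-, -, h3, h4, h5, h6, -, -⟩ := fan2_window hg hk hkg
  obtain ⟨-, -, h1, h2, -, -, -, -⟩ := fan2_window hg hk hkg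
  have ha := hu.2
  obtain ⟨hpos, -, -, -, -, -, -, -⟩ := fan2_window hg hk hkg
  constructor <;> linarith [ha.1, ha.2]

/-- The rotated angle is continuous at non-zero points of the two-edged fan. [folklore] -/
theorem continuousAt_ang_of_mem_fanF {u : 𝔼 2} (hu : u ∈ fanF g k) (hu0 : u ≠ 0) : ContinuousAt (ang (μk g k)) u :=
  continuousAt_ang hu0 (by have := (ang_window_of_mem_fanF hg hk hkg hu).2; intro h; rw [h] at this; linarith)

/-- The lower half lies in the fan. [folklore] -/
theorem fanFlo_subset_fanF : fanFlo g k ⊆ fanF g k := by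
  rintro u ⟨hq, h1, h2⟩
  obtain ⟨-, -, h3, -, -, h6, -, -⟩ := fan2_window hg hk hkg
  refine ⟨hq, h1, ?_⟩
  rw [h6]
  have : π / g ≤ μk g k := by linarith [(fan2_window hg hk hkg).2.1, (fan2_window hg hk hkg).1]
  linarith

/-- Far points of the lower half in the collar region lie in the lower valley half-zone. [folklore] -/
theorem far2_of_mem {u : 𝔼 2} (hu : u ∈ fanFlo g k) (hU : u ∈ collarU2 g k) (hr : 1 / 8 ≤ ‖u‖) :
    u ≠ 0 ∧ ang (μk g k) u < π / g + π / (2 * g) := by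
  obtain ⟨h0, h1, -, -, -, h6, -, h8⟩ := fan2_window hg hk hkg
  rcases hU with (h | h) | h
  · rw [mem_ball, dist_zero_right] at h; linarith
  · exact ⟨h.1, h.2.2⟩
  · exfalso
    have := hu.2.2
    rw [h6] at h
    linarith [h.2.1]

omit hg hk hkg in
/-- The squeezed angle lies in `[π/g, θ]`. [folklore] -/
theorem sqAng2_mem {s : ℝ} (hs : s ∈ Icc (0 : ℝ) 1) {u : 𝔼 2} (hu : u ∈ fanFlo g k) :
    π / g ≤ sqAng2 g k s u ∧ sqAng2 g k s u ≤ ang (μk g k) u := by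
  have ha := hu.2.1
  rw [sqAng2]; constructor <;> nlinarith [hs.1, hs.2]

/-- In the far part the squeezed angle lies in the standard valley zone. [folklore] -/
theorem sqAng2_mem_zone {s : ℝ} (hs : s ∈ Icc (0 : ℝ) 1) {u : 𝔼 2} (hu : u ∈ fanFlo g k)
    (hfar : ang (μk g k) u < π / g + π / (2 * g)) : sqAng2 g k s u ∈ Icc (π / (2 * g)) (3 * π / (2 * (g : ℝ))) := by
  have h := sqAng2_mem hs hu
  obtain ⟨h0, -, -, -, -, -, h7, -⟩ := fan2_window hg hk hkg
  have hz := valley_mem_Icc (g := g) (by omega)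
  exact ⟨le_trans hz.1 h.1, by linarith [h.2]⟩

/-- **The key inequality in the far part**: `‖u‖ ≤ R_s`. [folklore] -/
theorem norm_le_Rtot2 {s : ℝ} (hs : s ∈ Icc (0 : ℝ) 1) {u : 𝔼 2} (hu : u ∈ fanFlo g k)
    (hfar : ang (μk g k) u < π / g + π / (2 * g)) : ‖u‖ ≤ Rtot hg (sqAng2 g k s u) (flower g u) := by
  have hg1 : 1 ≤ g := by omega
  have hzone := sqAng2_mem_zone hg hk hkg hs hu hfar
  have hsq := sqAng2_mem hs hu
  have h0 : 0 ≤ flower g u := flower_nonneg hg u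
  have h1 : flower g u ≤ vmax hg (sqAng2 g k s u) := flower_le_vmax_of_le hg hu.1 _
  have hR := flower_pol_Rtot hg hzone h0 h1
  have hmono := strictMonoOn_flower_pol_of_cos_nonpos hg (cos_nonpos_of_mem hg1 hzone.1 hzone.2)
  obtain ⟨hp0, -, -, -, -, -, h7, -⟩ := fan2_window hg hk hkg
  have h2 : ang (μk g k) u ≤ 2 * π / g := by
    have : π / g + π / (2 * g) ≤ 2 * π / g := by
      have e1 : π / (2 * (g : ℝ)) = (1 / 2) * (π / g) := by field_simp
      rw [e1]; have : 2 * π / g = 2 * (π / g) := by ring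
      rw [this]; nlinarith [show 0 < π / g by positivity]
    linarith
  have hle : flower g (pol ‖u‖ (sqAng2 g k s u)) ≤ flower g (pol ‖u‖ (ang (μk g k) u)) :=
    flower_pol_le_of_angle_le' hg1 (norm_nonneg u) hsq.1 hsq.2 h2
  rw [pol_norm_ang, ← hR] at hle
  exact (hmono.le_iff_le (norm_nonneg u) (Rtot_mem hg _ _).1).1 hle

/-- The radius of the fold lies in `[0, ‖u‖]`. [folklore] -/
theorem foldRadius_mem {u : 𝔼 2} (hu : u ∈ fanFlo g k) :
    0 ≤ ‖u‖ * ((μk g k - ang (μk g k) u) / (μk g k - π / g)) ∧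
      ‖u‖ * ((μk g k - ang (μk g k) u) / (μk g k - π / g)) ≤ ‖u‖ := by
  obtain ⟨h0, h1, -, -, -, -, -, -⟩ := fan2_window hg hk hkg
  have hw : 0 < μk g k - π / g := by linarith
  have ha := hu.2
  have hq : 0 ≤ (μk g k - ang (μk g k) u) / (μk g k - π / g) := div_nonneg (by linarith [ha.2]) hw.le
  have hq1 : (μk g k - ang (μk g k) u) / (μk g k - π / g) ≤ 1 := (div_le_one hw).2 (by linarith [ha.1])
  exact ⟨mul_nonneg (norm_nonneg u) hq, mul_le_of_le_one_right (norm_nonneg u) hq1⟩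

/-- The norm of the fold. [folklore] -/
theorem norm_fold {u : 𝔼 2} (hu : u ∈ fanFlo g k) :
    ‖fold g k u‖ = ‖u‖ * ((μk g k - ang (μk g k) u) / (μk g k - π / g)) := by
  rw [fold, norm_pol, abs_of_nonneg (foldRadius_mem hg hk hkg hu).1]

/-- The norm of the fold line is at most `‖u‖` (`s ∈ [0, 1]`). [folklore] -/
theorem norm_foldLine_le {s : ℝ} (hs : s ∈ Icc (0 : ℝ) 1) {u : 𝔼 2} (hu : u ∈ fanFlo g k) :
    ‖(1 - s) • u + s • fold g k u‖ ≤ ‖u‖ := by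
  have hf := norm_fold hg hk hkg hu
  have hfr := foldRadius_mem hg hk hkg hu
  calc ‖(1 - s) • u + s • fold g k u‖ ≤ ‖(1 - s) • u‖ + ‖s • fold g k u‖ := norm_add_le _ _
    _ = (1 - s) * ‖u‖ + s * ‖fold g k u‖ := by
        rw [norm_smul, norm_smul, Real.norm_eq_abs, Real.norm_eq_abs, abs_of_nonneg (by linarith [hs.2]),
          abs_of_nonneg hs.1]
    _ ≤ (1 - s) * ‖u‖ + s * ‖u‖ := by rw [hf]; nlinarith [hs.1, hfr.2, hfr.1]
    _ = ‖u‖ := by ring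

omit hk hkg in
/-- Near the origin the deformation is the fold line. [folklore] -/
theorem loΦ_of_norm_le {s : ℝ} {u : 𝔼 2} (hr : ‖u‖ ≤ 1 / 8) : loΦ hg k s u = (1 - s) • u + s • fold g k u := by
  rw [loΦ, lam2_eq_zero hr]; simp

/-- **A bound on the flower-preserving radius near the origin**: if `‖u‖ ≤ 1/4` then `R_s < 1/2`. [folklore] -/
theorem Rtot_lt_half {s : ℝ} (hs : s ∈ Icc (0 : ℝ) 1) {u : 𝔼 2} (hu : u ∈ fanFlo g k)
    (hfar : ang (μk g k) u < π / g + π / (2 * g)) (hr : ‖u‖ ≤ 1 / 4) :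
    Rtot hg (sqAng2 g k s u) (flower g u) < 1 / 2 := by
  set R := Rtot hg (sqAng2 g k s u) (flower g u) with hRdef
  have hzone := sqAng2_mem_zone hg hk hkg hs hu hfar
  have hR := flower_pol_Rtot hg hzone (flower_nonneg hg u) (flower_le_vmax_of_le hg hu.1 _)
  have hR0 : 0 ≤ R := (Rtot_mem hg _ _).1
  -- `vprof R ≤ q u ≤ prof ‖u‖ ≤ prof (1/4) < 1/8 ≤ vprof (1/2)`
  have h1 : vprof g R ≤ flower g u := by rw [← hR]; exact vprof_le_flower_pol hR0 _
  have h2 : flower g u ≤ prof g ‖u‖ := by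
    have := flower_pol_le_prof (g := g) (norm_nonneg u) (ang (μk g k) u); rwa [pol_norm_ang] at this
  have h3 : prof g ‖u‖ ≤ prof g (1 / 4) :=
    (strictMonoOn_prof_left hg).monotoneOn ⟨norm_nonneg u, le_trans hr (by linarith [(rho1_mem hg).1, (rho1_mem hg).2, one_lt_ra hg])⟩
      ⟨by norm_num, by linarith [(rho1_mem hg).1, (rho1_mem hg).2, one_lt_ra hg]⟩ hr
  have h4 : prof g (1 / 4) < 1 / 8 := by
    have hV := V_le_half_sq hg (by norm_num : (0:ℝ) ≤ 1 / 4) (by norm_num)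
    rw [prof_eq]; nlinarith
  have h5 : 1 / 8 ≤ vprof g (1 / 2) := by
    have hV := V_le_half_sq hg (by norm_num : (0:ℝ) ≤ 1 / 2) (by norm_num)
    rw [vprof]; nlinarith
  by_contra hge
  push Not at hge
  have hmono := (strictMonoOn_vprof hg).monotoneOn (by norm_num : (1/2 : ℝ) ∈ Ici 0) (hR0 : R ∈ Ici (0:ℝ)) hge
  linarith

/-- **The deformation stays in the flower domain.** [folklore] -/
theorem flower_loΦ_le {s : ℝ} (hs : s ∈ Icc (0 : ℝ) 1) {u : 𝔼 2} (hu : u ∈ fanFlo g k) (hU : u ∈ collarU2 g k) :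
    flower g (loΦ hg k s u) ≤ level g := by
  rcases le_or_gt (1 / 4) ‖u‖ with hr | hr
  · obtain ⟨-, hfar⟩ := far2_of_mem hg hk hkg hu hU (by linarith)
    have hzone := sqAng2_mem_zone hg hk hkg hs hu hfar
    rw [loΦ, lam2_eq_one hr]
    simp only [sub_self, zero_smul, zero_add, one_smul]
    rw [farPt, flower_pol_Rtot hg hzone (flower_nonneg hg u) (flower_le_vmax_of_le hg hu.1 _)]
    exact hu.1
  · -- near the origin everything has norm `< 1/2`
    have hnorm : ‖loΦ hg k s u‖ ≤ 1 / 2 := by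
      have hl := lam2_mem ‖u‖
      have hA := norm_foldLine_le hg hk hkg hs hu
      rcases lt_or_ge ‖u‖ (1 / 8) with h8 | h8
      · rw [loΦ_of_norm_le hg h8.le]; linarith
      · obtain ⟨-, hfar⟩ := far2_of_mem hg hk hkg hu hU h8
        have hB : ‖farPt hg k s u‖ < 1 / 2 := by
          rw [farPt, norm_pol, abs_of_nonneg (Rtot_mem hg _ _).1]; exact Rtot_lt_half hg hk hkg hs hu hfar hr.le
        rw [loΦ]
        calc ‖(1 - lam2 ‖u‖) • ((1 - s) • u + s • fold g k u) + lam2 ‖u‖ • farPt hg k s u‖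
            ≤ ‖(1 - lam2 ‖u‖) • ((1 - s) • u + s • fold g k u)‖ + ‖lam2 ‖u‖ • farPt hg k s u‖ := norm_add_le _ _
          _ = (1 - lam2 ‖u‖) * ‖(1 - s) • u + s • fold g k u‖ + lam2 ‖u‖ * ‖farPt hg k s u‖ := by
              rw [norm_smul, norm_smul, Real.norm_eq_abs, Real.norm_eq_abs, abs_of_nonneg (by linarith [hl.2]),
                abs_of_nonneg hl.1]
          _ ≤ (1 - lam2 ‖u‖) * (1 / 2) + lam2 ‖u‖ * (1 / 2) := by nlinarith [hl.1, hl.2, norm_nonneg ((1 - s) • u + s • fold g k u)]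
          _ = 1 / 2 := by ring
    have h := flower_pol_le_prof (g := g) (norm_nonneg (loΦ hg k s u)) (ang 0 (loΦ hg k s u))
    rw [pol_norm_ang] at h
    exact le_trans h (prof_lt_level_of_le hg (norm_nonneg _) (by linarith)).le


/-- The angle of the fold point (non-degenerate case). [folklore] -/
theorem fold_mem_cone {u : 𝔼 2} (hu : u ∈ fanFlo g k) {b : ℝ} (hb : π / g ≤ b) (hbπ : b ≤ π / g + π) :
    fold g k u ∈ cone (π / g) b :=
  pol_mem_cone (foldRadius_mem hg hk hkg hu).1 le_rfl hb hbπ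

/-- `u` lies in the cone between the lower edge and its own angle. [folklore] -/
theorem self_mem_cone {u : 𝔼 2} (hu : u ∈ fanFlo g k) : u ∈ cone (π / g) (ang (μk g k) u) := by
  obtain ⟨-, -, h3, -, -, -, -, -⟩ := fan2_window hg hk hkg
  have h := pol_mem_cone (norm_nonneg u) hu.2.1 le_rfl (by linarith [hu.2.2])
  rwa [pol_norm_ang] at h

/-- The far point lies in the cone between the lower edge and the angle of `u`. [folklore] -/
theorem farPt_mem_cone {s : ℝ} (hs : s ∈ Icc (0 : ℝ) 1) {u : 𝔼 2} (hu : u ∈ fanFlo g k) :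
    farPt hg k s u ∈ cone (π / g) (ang (μk g k) u) := by
  obtain ⟨-, -, h3, -, -, -, -, -⟩ := fan2_window hg hk hkg
  have h := sqAng2_mem hs hu
  exact pol_mem_cone (Rtot_mem hg _ _).1 h.1 h.2 (by linarith [hu.2.2])

/-- **The deformed point lies in the cone between the lower edge and the angle of `u`.** [folklore] -/
theorem loΦ_mem_cone {s : ℝ} (hs : s ∈ Icc (0 : ℝ) 1) {u : 𝔼 2} (hu : u ∈ fanFlo g k) :
    loΦ hg k s u ∈ cone (π / g) (ang (μk g k) u) := by
  obtain ⟨-, -, h3, -, -, -, -, -⟩ := fan2_window hg hk hkg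
  have hconv := convex_cone (π / g) (ang (μk g k) u)
  have hA : (1 - s) • u + s • fold g k u ∈ cone (π / g) (ang (μk g k) u) :=
    hconv (self_mem_cone hg hk hkg hu) (fold_mem_cone hg hk hkg hu hu.2.1 (by linarith [hu.2.2]))
      (by linarith [hs.2]) hs.1 (by ring)
  have hl := lam2_mem ‖u‖
  exact hconv hA (farPt_mem_cone hg hk hkg hs hu) (by linarith [hl.2]) hl.1 (by ring)

/-- On the lower edge the deformation is the identity. [folklore] -/
theorem loΦ_eq_self_of_ang_eq {s : ℝ} {u : 𝔼 2} (hu : u ∈ fanFlo g k)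
    (hfar : ang (μk g k) u < π / g + π / (2 * g)) (hθ : ang (μk g k) u = π / g) : loΦ hg k s u = u := by
  obtain ⟨h0, h1, -, -, -, -, -, -⟩ := fan2_window hg hk hkg
  have hw : μk g k - π / g ≠ 0 := by linarith
  have hfold : fold g k u = u := by
    rw [fold, hθ, div_self hw, mul_one]
    conv_rhs => rw [← pol_norm_ang (μk g k) u, hθ]
  have hsq : sqAng2 g k s u = π / g := by rw [sqAng2, hθ]; ring
  have hfar' : farPt hg k s u = u := by
    rw [farPt, hsq]
    have hR : Rtot hg (π / g) (flower g u) = ‖u‖ :=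
      Rtot_eq hg (valley_mem_Icc (by omega)) (flower_nonneg hg u) (flower_le_vmax_of_le hg hu.1 _) (norm_nonneg u)
        (by conv_rhs => rw [← pol_norm_ang (μk g k) u, hθ])
    rw [hR]
    conv_rhs => rw [← pol_norm_ang (μk g k) u, hθ]
  rw [loΦ, hfold, hfar', ← add_smul, show (1 : ℝ) - s + s = 1 by ring, one_smul, ← add_smul]
  simp

/-- **The deformation maps the collar region of the lower half into itself.** [folklore] -/
theorem loΦ_mem {s : ℝ} (hs : s ∈ Icc (0 : ℝ) 1) {u : 𝔼 2} (hu : u ∈ fanFlo g k) (hU : u ∈ collarU2 g k) :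
    loΦ hg k s u ∈ fanFlo g k ∩ collarU2 g k := by
  obtain ⟨h0, h1, h3, h4, -, -, -, h8⟩ := fan2_window hg hk hkg
  have hq := flower_loΦ_le hg hk hkg hs hu hU
  set v := loΦ hg k s u with hv
  -- the angle of `v`
  have hang : v ≠ 0 → ang (μk g k) v ∈ Icc (π / g) (ang (μk g k) u) := fun hv0 => by
    rcases hu.2.1.eq_or_lt with hθ | hθ
    · -- `u` on the lower edge: `v = u`
      have hfar : ang (μk g k) u < π / g + π / (2 * g) := by rw [← hθ]; linarith
      have : v = u := loΦ_eq_self_of_ang_eq hg hk hkg hu hfar hθ.symm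
      rw [this, ← hθ]; exact ⟨le_rfl, le_rfl⟩
    · exact ang_mem_of_mem_cone hθ (by linarith) (by linarith [hu.2.2]) (loΦ_mem_cone hg hk hkg hs hu) hv0
  have hvlo : v ∈ fanFlo g k := by
    refine ⟨hq, ?_⟩
    by_cases hv0 : v = 0
    · rw [hv0, ang_zero]; exact ⟨by linarith, le_rfl⟩
    · have h := hang hv0
      exact ⟨h.1, le_trans h.2 hu.2.2⟩
  refine ⟨hvlo, ?_⟩
  rcases lt_or_ge ‖u‖ (1 / 8) with hr | hr
  · left; left
    rw [mem_ball, dist_zero_right, hv, loΦ_of_norm_le hg hr.le]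
    exact lt_of_le_of_lt (norm_foldLine_le hg hk hkg hs hu) hr
  · obtain ⟨hu0, hfar⟩ := far2_of_mem hg hk hkg hu hU hr
    by_cases hv0 : v = 0
    · left; left; rw [hv0]; exact mem_ball_self (by norm_num)
    · left; right
      have h := hang hv0
      exact ⟨hv0, by linarith [h.1], lt_of_le_of_lt h.2 hfar⟩

/-- **Seam points go to seam points.** [folklore] -/
theorem flower_loΦ_eq {s : ℝ} (hs : s ∈ Icc (0 : ℝ) 1) {u : 𝔼 2} (hu : u ∈ fanFlo g k) (hU : u ∈ collarU2 g k)
    (hseam : flower g u = level g) : flower g (loΦ hg k s u) = level g := by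
  have hbig : 1 / 4 ≤ ‖u‖ := by
    have h1 : level g ≤ prof g ‖u‖ := by
      have := flower_pol_le_prof (g := g) (norm_nonneg u) (ang (μk g k) u)
      rw [pol_norm_ang, hseam] at this; exact this
    rcases (level_le_prof_iff hg (norm_nonneg u)).1 h1 with h | h
    · linarith [h.1, (rho1_mem hg).1]
    · linarith [rt_seven_lt_rho3 hg, one_le_rt (g := g) (by norm_num : (1:ℝ) ≤ 7)]
  obtain ⟨-, hfar⟩ := far2_of_mem hg hk hkg hu hU (by linarith)
  have hzone := sqAng2_mem_zone hg hk hkg hs hu hfar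
  rw [loΦ, lam2_eq_one hbig]
  simp only [sub_self, zero_smul, zero_add, one_smul]
  rw [farPt, flower_pol_Rtot hg hzone (flower_nonneg hg u) (flower_le_vmax_of_le hg hu.1 _), hseam]

/-- **At time `0` the deformation is the identity.** [folklore] -/
theorem loΦ_zero {u : 𝔼 2} (hu : u ∈ fanFlo g k) (hU : u ∈ collarU2 g k) : loΦ hg k 0 u = u := by
  have h0 : sqAng2 g k 0 u = ang (μk g k) u := by rw [sqAng2]; ring
  rcases lt_or_ge ‖u‖ (1 / 8) with hr | hr
  · rw [loΦ_of_norm_le hg hr.le]; simp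
  · obtain ⟨-, hfar⟩ := far2_of_mem hg hk hkg hu hU hr
    have hzone : ang (μk g k) u ∈ Icc (π / (2 * g)) (3 * π / (2 * (g : ℝ))) := by
      have := sqAng2_mem_zone hg hk hkg (⟨le_rfl, zero_le_one⟩ : (0:ℝ) ∈ Icc 0 1) hu hfar
      rwa [h0] at this
    have hR : Rtot hg (ang (μk g k) u) (flower g u) = ‖u‖ :=
      Rtot_eq hg hzone (flower_nonneg hg u) (flower_le_vmax_of_le hg hu.1 _) (norm_nonneg u) (by rw [pol_norm_ang])
    have hfar' : farPt hg k 0 u = u := by rw [farPt, h0, hR, pol_norm_ang]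
    rw [loΦ, hfar']
    simp only [sub_zero, one_smul, zero_smul, add_zero]
    rw [← add_smul]; simp

/-- **At time `1` the deformation lands on the lower edge ray segment.** [folklore] -/
theorem loΦ_one_mem {u : 𝔼 2} (hu : u ∈ fanFlo g k) : loΦ hg k 1 u ∈ vRay g hg := by
  have h1 : sqAng2 g k 1 u = π / g := by rw [sqAng2]; ring
  have hfr := foldRadius_mem hg hk hkg hu
  have hr4 : ‖u‖ ≤ rho4 hg := norm_le_rho4_of_flower_le hg hu.1
  rw [loΦ]
  simp only [sub_self, zero_smul, zero_add, one_smul]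
  rw [fold, farPt, h1]
  exact combo_pol_mem_vRay hg ⟨hfr.1, le_trans hfr.2 hr4⟩ (Rtot_mem hg _ _) (lam2_mem ‖u‖)

/-- **The deformation fixes the lower edge ray segment.** [folklore] -/
theorem loΦ_eq_self_of_mem_vRay (s : ℝ) {u : 𝔼 2} (hu : u ∈ vRay g hg) : loΦ hg k s u = u := by
  obtain ⟨r, ⟨hr0, hr4⟩, rfl⟩ := hu
  have hg1 : 1 ≤ g := by omega
  obtain ⟨h0, h1, h3, -, -, -, -, -⟩ := fan2_window hg hk hkg
  show loΦ hg k s (pol r (π / g)) = pol r (π / g)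
  rcases hr0.eq_or_lt with h | h
  · subst h
    rw [pol_zero_left, loΦ, norm_zero, lam2_eq_zero (by norm_num), fold, norm_zero, zero_mul, pol_zero_left]
    simp
  · have hwin : π / g - μk g k ∈ Ioc (-π) π := ⟨by linarith, by linarith⟩
    have hang : ang (μk g k) (pol r (π / g)) = π / g := ang_pol h hwin
    have hmem : pol r (π / g) ∈ fanFlo g k := by
      refine ⟨by rw [flower_pol_valley hg1]; exact (vprof_le_level_iff hg h.le).2 hr4, ?_⟩
      rw [hang]; exact ⟨le_rfl, by linarith⟩
    exact loΦ_eq_self_of_ang_eq hg hk hkg hmem (by rw [hang]; linarith) hang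

/-- **Continuity of the lower-half deformation** on `ℝ × (lower half ∩ collar region)`. [folklore] -/
theorem continuousOn_loΦ : ContinuousOn (fun x : ℝ × 𝔼 2 => loΦ hg k x.1 x.2) ((univ : Set ℝ) ×ˢ (fanFlo g k ∩ collarU2 g k)) := by
  rintro ⟨t, u⟩ ⟨-, hu, hU⟩
  by_cases hu0 : u = 0
  · subst hu0
    have hval : loΦ hg k t 0 = 0 := by
      rw [loΦ, norm_zero, lam2_eq_zero (by norm_num), fold, norm_zero, zero_mul, pol_zero_left]; simp
    rw [ContinuousWithinAt, hval]
    have hsmall : ∀ᶠ x : ℝ × 𝔼 2 in 𝓝[(univ : Set ℝ) ×ˢ (fanFlo g k ∩ collarU2 g k)] (t, 0),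
        ‖x.2‖ < 1 / 8 ∧ x ∈ (univ : Set ℝ) ×ˢ (fanFlo g k ∩ collarU2 g k) ∧ |x.1 - t| < 1 := by
      refine Filter.Eventually.and ?_ (Filter.Eventually.and self_mem_nhdsWithin ?_)
      · have : ∀ᶠ x : ℝ × 𝔼 2 in 𝓝 (t, (0 : 𝔼 2)), ‖x.2‖ < 1 / 8 :=
          (continuous_norm.comp continuous_snd).continuousAt.eventually (gt_mem_nhds (by simp))
        exact this.filter_mono nhdsWithin_le_nhds
      · have : ∀ᶠ x : ℝ × 𝔼 2 in 𝓝 (t, (0 : 𝔼 2)), |x.1 - t| < 1 := by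
          have hc : Continuous fun x : ℝ × 𝔼 2 => |x.1 - t| := by fun_prop
          exact hc.continuousAt.eventually (gt_mem_nhds (by simp))
        exact this.filter_mono nhdsWithin_le_nhds
    have hbound : ∀ᶠ x : ℝ × 𝔼 2 in 𝓝[(univ : Set ℝ) ×ˢ (fanFlo g k ∩ collarU2 g k)] (t, 0),
        ‖loΦ hg k x.1 x.2‖ ≤ (2 * |t| + 3) * ‖x.2‖ := by
      refine hsmall.mono ?_
      rintro ⟨s, v⟩ ⟨hv, ⟨-, hvlo, -⟩, hst⟩
      have hv' : ‖v‖ < 1 / 8 := hv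
      have hst' : |s - t| < 1 := hst
      have hvlo' : v ∈ fanFlo g k := hvlo
      show ‖loΦ hg k s v‖ ≤ (2 * |t| + 3) * ‖v‖
      rw [loΦ_of_norm_le hg hv'.le]
      have hf := norm_fold hg hk hkg hvlo'
      have hfr := foldRadius_mem hg hk hkg hvlo'
      have hfle : ‖fold g k v‖ ≤ ‖v‖ := by rw [hf]; exact hfr.2
      have hs2 : |s| ≤ |t| + 1 := by linarith [abs_sub_abs_le_abs_sub s t]
      have hs1 : |1 - s| ≤ |t| + 2 := by
        calc |1 - s| ≤ |1| + |s| := abs_sub _ _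
          _ ≤ |t| + 2 := by rw [abs_one]; linarith
      calc ‖(1 - s) • v + s • fold g k v‖ ≤ ‖(1 - s) • v‖ + ‖s • fold g k v‖ := norm_add_le _ _
        _ = |1 - s| * ‖v‖ + |s| * ‖fold g k v‖ := by rw [norm_smul, norm_smul, Real.norm_eq_abs, Real.norm_eq_abs]
        _ ≤ (|t| + 2) * ‖v‖ + (|t| + 1) * ‖v‖ :=
            add_le_add (mul_le_mul_of_nonneg_right hs1 (norm_nonneg v))
              (le_trans (mul_le_mul_of_nonneg_left hfle (abs_nonneg s)) (mul_le_mul_of_nonneg_right hs2 (norm_nonneg v)))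
        _ = (2 * |t| + 3) * ‖v‖ := by ring
    have hlim : Tendsto (fun x : ℝ × 𝔼 2 => (2 * |t| + 3) * ‖x.2‖) (𝓝[(univ : Set ℝ) ×ˢ (fanFlo g k ∩ collarU2 g k)] (t, 0)) (𝓝 0) := by
      have : Tendsto (fun x : ℝ × 𝔼 2 => (2 * |t| + 3) * ‖x.2‖) (𝓝 ((t, (0 : 𝔼 2)))) (𝓝 0) := by
        have hc : Continuous fun x : ℝ × 𝔼 2 => (2 * |t| + 3) * ‖x.2‖ := by fun_prop
        exact hc.tendsto' (t, (0 : 𝔼 2)) 0 (by simp)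
      exact this.mono_left nhdsWithin_le_nhds
    exact squeeze_zero_norm' hbound hlim
  · -- away from the origin
    have hang : ContinuousAt (fun x : ℝ × 𝔼 2 => ang (μk g k) x.2) (t, u) :=
      (continuousAt_ang_of_mem_fanF hg hk hkg (fanFlo_subset_fanF hg hk hkg hu) hu0).comp_of_eq
        continuous_snd.continuousAt rfl
    have h1 : ContinuousAt (fun x : ℝ × 𝔼 2 => x.1) (t, u) := continuous_fst.continuousAt
    have hθ : ContinuousAt (fun x : ℝ × 𝔼 2 => sqAng2 g k x.1 x.2) (t, u) := by
      unfold sqAng2; exact hang.sub (h1.mul (hang.sub continuousAt_const))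
    have hq : ContinuousAt (fun x : ℝ × 𝔼 2 => flower g x.2) (t, u) :=
      (contDiff_flower.continuous.comp continuous_snd).continuousAt
    have hR : ContinuousAt (fun x : ℝ × 𝔼 2 => Rtot hg (sqAng2 g k x.1 x.2) (flower g x.2)) (t, u) :=
      (continuous_Rtot hg).continuousAt.comp_of_eq (hθ.prodMk hq) rfl
    have hr : ContinuousAt (fun x : ℝ × 𝔼 2 => ‖x.2‖) (t, u) := by fun_prop
    have hl : ContinuousAt (fun x : ℝ × 𝔼 2 => lam2 ‖x.2‖) (t, u) := continuous_lam2.continuousAt.comp_of_eq hr rfl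
    have hfoldR : ContinuousAt (fun x : ℝ × 𝔼 2 => ‖x.2‖ * ((μk g k - ang (μk g k) x.2) / (μk g k - π / g))) (t, u) :=
      hr.mul ((continuousAt_const.sub hang).div_const _)
    have hfold : ContinuousAt (fun x : ℝ × 𝔼 2 => fold g k x.2) (t, u) := by
      show ContinuousAt ((fun p : ℝ × ℝ => pol p.1 p.2) ∘ fun x : ℝ × 𝔼 2 =>
        (‖x.2‖ * ((μk g k - ang (μk g k) x.2) / (μk g k - π / g)), π / g)) (t, u)
      exact continuous_pol.continuousAt.comp (hfoldR.prodMk continuousAt_const)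
    have hfar : ContinuousAt (fun x : ℝ × 𝔼 2 => farPt hg k x.1 x.2) (t, u) := by
      show ContinuousAt ((fun p : ℝ × ℝ => pol p.1 p.2) ∘ fun x : ℝ × 𝔼 2 =>
        (Rtot hg (sqAng2 g k x.1 x.2) (flower g x.2), sqAng2 g k x.1 x.2)) (t, u)
      exact continuous_pol.continuousAt.comp (hR.prodMk hθ)
    have hu2 : ContinuousAt (fun x : ℝ × 𝔼 2 => x.2) (t, u) := continuous_snd.continuousAt
    have hall : ContinuousAt (fun x : ℝ × 𝔼 2 => loΦ hg k x.1 x.2) (t, u) := by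
      unfold loΦ
      exact ((continuousAt_const.sub hl).smul (((continuousAt_const.sub h1).smul hu2).add (h1.smul hfold))).add
        (hl.smul hfar)
    exact hall.continuousWithinAt


/-! #### The bisector reflection and the full two-edged collar deformation -/

omit hk hkg in
/-- **The bisector reflection** `σ = rot(ζ^{k+1}) ∘ refl`: the reflection of the plane in the line
at angle `μ_k`, a symmetry of the flower swapping the two edges of the fan. [folklore] -/
theorem σ_pol (r θ : ℝ) : rot (ζC g (k + 1)) (refl (pol r θ)) = pol r (2 * μk g k - θ) := by
  have hg1 : 1 ≤ g := by omega
  rw [refl_pol, rot_pol hg1 (k + 1), μk]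
  congr 1
  push_cast
  ring

variable (g k) in
/-- The bisector reflection as a map. [folklore] -/
def bisRefl (u : 𝔼 2) : 𝔼 2 := rot (ζC g (k + 1)) (refl u)

omit hk hkg in
/-- The bisector reflection in polar form. [folklore] -/
theorem bisRefl_eq (u : 𝔼 2) : bisRefl g k u = pol ‖u‖ (2 * μk g k - ang (μk g k) u) := by
  conv_lhs => rw [bisRefl, ← pol_norm_ang (μk g k) u]
  exact σ_pol hg _ _

omit hg hk hkg in
/-- The bisector reflection is continuous. [folklore] -/
theorem continuous_bisRefl : Continuous (bisRefl g k) := (rot _).continuous.comp refl.continuous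

omit hg hk hkg in
/-- The bisector reflection is linear (as the composite of two linear isometries). [folklore] -/
theorem bisRefl_smul (t : ℝ) (u : 𝔼 2) : bisRefl g k (t • u) = t • bisRefl g k u := by
  rw [bisRefl, bisRefl, LinearIsometryEquiv.map_smul, LinearIsometryEquiv.map_smul]

omit hg hk hkg in
/-- The bisector reflection preserves the norm. [folklore] -/
@[simp] theorem norm_bisRefl (u : 𝔼 2) : ‖bisRefl g k u‖ = ‖u‖ := by rw [bisRefl, norm_rot, norm_refl]

omit hg hk hkg in
/-- `σ 0 = 0`. [folklore] -/
@[simp] theorem bisRefl_zero : bisRefl g k 0 = 0 := by rw [bisRefl, refl_zero, map_zero]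

omit hk hkg in
/-- The bisector reflection is an involution. [folklore] -/
@[simp] theorem bisRefl_bisRefl (u : 𝔼 2) : bisRefl g k (bisRefl g k u) = u := by
  rw [bisRefl_eq hg u, bisRefl, σ_pol hg]
  conv_rhs => rw [← pol_norm_ang (μk g k) u]
  congr 1; ring

omit hk hkg in
/-- **The bisector reflection is a symmetry of the flower.** [folklore] -/
theorem flower_bisRefl (u : 𝔼 2) : flower g (bisRefl g k u) = flower g u := by
  rw [bisRefl, flower_rot (ζC_pow (by omega) _), flower_refl]

/-- The rotated angle of a reflected fan point. [folklore] -/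
theorem ang_bisRefl {u : 𝔼 2} (hu : u ∈ fanF g k) : ang (μk g k) (bisRefl g k u) = 2 * μk g k - ang (μk g k) u := by
  by_cases hu0 : u = 0
  · rw [hu0, bisRefl_zero, ang_zero]; ring
  · have hw := ang_window_of_mem_fanF hg hk hkg hu
    rw [bisRefl_eq hg u]
    exact ang_pol (norm_pos_iff.2 hu0) ⟨by linarith [hw.2], by linarith [hw.1]⟩

/-- The bisector reflection maps the fan to itself. [folklore] -/
theorem bisRefl_mem_fanF {u : 𝔼 2} (hu : u ∈ fanF g k) : bisRefl g k u ∈ fanF g k := by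
  obtain ⟨-, -, -, -, -, h6, -, -⟩ := fan2_window hg hk hkg
  refine ⟨by rw [flower_bisRefl hg]; exact hu.1, ?_⟩
  rw [ang_bisRefl hg hk hkg hu, h6]
  have := hu.2; rw [h6] at this
  constructor <;> linarith [this.1, this.2]

/-- Upper-half points reflect into the lower half. [folklore] -/
theorem bisRefl_mem_fanFlo {u : 𝔼 2} (hu : u ∈ fanF g k) (hup : μk g k ≤ ang (μk g k) u) :
    bisRefl g k u ∈ fanFlo g k := by
  obtain ⟨-, -, -, -, -, h6, -, -⟩ := fan2_window hg hk hkg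
  refine ⟨by rw [flower_bisRefl hg]; exact hu.1, ?_⟩
  rw [ang_bisRefl hg hk hkg hu]
  have := hu.2; rw [h6] at this
  constructor <;> linarith [this.2]

/-- The bisector reflection maps the collar region to itself (on the fan). [folklore] -/
theorem bisRefl_mem_collarU2 {u : 𝔼 2} (hu : u ∈ fanF g k) (hU : u ∈ collarU2 g k) : bisRefl g k u ∈ collarU2 g k := by
  obtain ⟨-, -, -, -, -, h6, -, -⟩ := fan2_window hg hk hkg
  have hne : u ≠ 0 → bisRefl g k u ≠ 0 := fun h h' => h (by
    have := congrArg (fun v : 𝔼 2 => ‖v‖) h'; simpa using this)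
  rcases hU with (h | ⟨h0, h1, h2⟩) | ⟨h0, h1, h2⟩
  · left; left; rw [mem_ball, dist_zero_right] at h ⊢; rwa [norm_bisRefl]
  · right
    refine ⟨hne h0, ?_, ?_⟩ <;> rw [ang_bisRefl hg hk hkg hu, h6] <;> linarith
  · left; right
    refine ⟨hne h0, ?_, ?_⟩ <;> rw [ang_bisRefl hg hk hkg hu] <;> rw [h6] at h1 h2 <;> linarith

/-- **The full collar deformation of the two-edged fan**: the lower-half deformation on the lower
half, its conjugate by the bisector reflection on the upper half. [folklore] -/
def Ψ2 (s : ℝ) (u : 𝔼 2) : 𝔼 2 :=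
  if ang (μk g k) u ≤ μk g k then loΦ hg k s u else bisRefl g k (loΦ hg k s (bisRefl g k u))

variable (g) in
/-- The two edge ray segments of the fan. [folklore] -/
def vRay2 (k : ℕ) (hg : 2 ≤ g) : Set (𝔼 2) := vRay g hg ∪ bisRefl g k '' vRay g hg

/-- Points of the domain on the bisector lie in the small disc. [folklore] -/
theorem norm_lt_of_bisector {u : 𝔼 2} (hU : u ∈ collarU2 g k) (hθ : ang (μk g k) u = μk g k) : ‖u‖ < 1 / 8 := by
  obtain ⟨h0, h1, -, -, -, h6, -, h8⟩ := fan2_window hg hk hkg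
  rcases hU with (h | ⟨-, -, h2⟩) | ⟨-, h3, -⟩
  · rwa [mem_ball, dist_zero_right] at h
  · rw [hθ] at h2; linarith
  · rw [hθ, h6] at h3; linarith

/-- On the bisector (inside the domain) the lower-half deformation is `(1 - s) u`. [folklore] -/
theorem loΦ_of_bisector {s : ℝ} {u : 𝔼 2} (hU : u ∈ collarU2 g k) (hθ : ang (μk g k) u = μk g k) :
    loΦ hg k s u = (1 - s) • u := by
  rw [loΦ_of_norm_le hg (norm_lt_of_bisector hg hk hkg hU hθ).le, fold, hθ, sub_self, zero_div, mul_zero,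
    pol_zero_left, smul_zero, add_zero]

/-- **The two branches agree on the bisector.** [folklore] -/
theorem branches_agree {s : ℝ} {u : 𝔼 2} (hu : u ∈ fanF g k) (hU : u ∈ collarU2 g k) (hθ : ang (μk g k) u = μk g k) :
    bisRefl g k (loΦ hg k s (bisRefl g k u)) = loΦ hg k s u := by
  have hθ' : ang (μk g k) (bisRefl g k u) = μk g k := by rw [ang_bisRefl hg hk hkg hu, hθ]; ring
  rw [loΦ_of_bisector hg hk hkg (bisRefl_mem_collarU2 hg hk hkg hu hU) hθ', loΦ_of_bisector hg hk hkg hU hθ,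
    bisRefl_smul, bisRefl_bisRefl hg]

omit hk hkg in
/-- The deformation on the lower half. [folklore] -/
theorem Ψ2_of_le {s : ℝ} {u : 𝔼 2} (h : ang (μk g k) u ≤ μk g k) : Ψ2 hg (k := k) s u = loΦ hg k s u := by
  rw [Ψ2, if_pos h]

/-- The deformation on the upper half (closed: including the bisector). [folklore] -/
theorem Ψ2_of_ge {s : ℝ} {u : 𝔼 2} (hu : u ∈ fanF g k) (hU : u ∈ collarU2 g k) (h : μk g k ≤ ang (μk g k) u) :
    Ψ2 hg (k := k) s u = bisRefl g k (loΦ hg k s (bisRefl g k u)) := by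
  rw [Ψ2]
  split_ifs with h'
  · exact (branches_agree hg hk hkg hu hU (le_antisymm h' h)).symm
  · rfl

/-- **The deformation maps the collar region of the fan into itself.** [folklore] -/
theorem Ψ2_mem {s : ℝ} (hs : s ∈ Icc (0 : ℝ) 1) {u : 𝔼 2} (hu : u ∈ fanF g k) (hU : u ∈ collarU2 g k) :
    Ψ2 hg (k := k) s u ∈ fanF g k ∩ collarU2 g k := by
  rcases le_total (ang (μk g k) u) (μk g k) with h | h
  · rw [Ψ2_of_le hg h]
    have := loΦ_mem hg hk hkg hs ⟨hu.1, hu.2.1, h⟩ hU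
    exact ⟨fanFlo_subset_fanF hg hk hkg this.1, this.2⟩
  · rw [Ψ2_of_ge hg hk hkg hu hU h]
    have h1 := loΦ_mem hg hk hkg hs (bisRefl_mem_fanFlo hg hk hkg hu h) (bisRefl_mem_collarU2 hg hk hkg hu hU)
    have h2 := fanFlo_subset_fanF hg hk hkg h1.1
    exact ⟨bisRefl_mem_fanF hg hk hkg h2, bisRefl_mem_collarU2 hg hk hkg h2 h1.2⟩

/-- The deformation stays in the domain. [folklore] -/
theorem flower_Ψ2_le {s : ℝ} (hs : s ∈ Icc (0 : ℝ) 1) {u : 𝔼 2} (hu : u ∈ fanF g k) (hU : u ∈ collarU2 g k) :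
    flower g (Ψ2 hg (k := k) s u) ≤ level g := (Ψ2_mem hg hk hkg hs hu hU).1.1

/-- **Seam points go to seam points.** [folklore] -/
theorem flower_Ψ2_eq {s : ℝ} (hs : s ∈ Icc (0 : ℝ) 1) {u : 𝔼 2} (hu : u ∈ fanF g k) (hU : u ∈ collarU2 g k)
    (hseam : flower g u = level g) : flower g (Ψ2 hg (k := k) s u) = level g := by
  rcases le_total (ang (μk g k) u) (μk g k) with h | h
  · rw [Ψ2_of_le hg h]; exact flower_loΦ_eq hg hk hkg hs ⟨hu.1, hu.2.1, h⟩ hU hseam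
  · rw [Ψ2_of_ge hg hk hkg hu hU h, flower_bisRefl hg]
    exact flower_loΦ_eq hg hk hkg hs (bisRefl_mem_fanFlo hg hk hkg hu h) (bisRefl_mem_collarU2 hg hk hkg hu hU)
      (by rw [flower_bisRefl hg]; exact hseam)

/-- **At time `0` the deformation is the identity.** [folklore] -/
theorem Ψ2_zero {u : 𝔼 2} (hu : u ∈ fanF g k) (hU : u ∈ collarU2 g k) : Ψ2 hg (k := k) 0 u = u := by
  rcases le_total (ang (μk g k) u) (μk g k) with h | h
  · rw [Ψ2_of_le hg h]; exact loΦ_zero hg hk hkg ⟨hu.1, hu.2.1, h⟩ hU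
  · rw [Ψ2_of_ge hg hk hkg hu hU h, loΦ_zero hg hk hkg (bisRefl_mem_fanFlo hg hk hkg hu h)
      (bisRefl_mem_collarU2 hg hk hkg hu hU), bisRefl_bisRefl hg]

/-- **At time `1` the deformation lands on the two edge ray segments.** [folklore] -/
theorem Ψ2_one_mem {u : 𝔼 2} (hu : u ∈ fanF g k) (hU : u ∈ collarU2 g k) : Ψ2 hg (k := k) 1 u ∈ vRay2 g k hg := by
  rcases le_total (ang (μk g k) u) (μk g k) with h | h
  · rw [Ψ2_of_le hg h]; exact Or.inl (loΦ_one_mem hg hk hkg ⟨hu.1, hu.2.1, h⟩)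
  · rw [Ψ2_of_ge hg hk hkg hu hU h]
    exact Or.inr ⟨_, loΦ_one_mem hg hk hkg (bisRefl_mem_fanFlo hg hk hkg hu h), rfl⟩

/-- Points of the lower edge ray have angle `π/g` (or are the origin). [folklore] -/
theorem ang_of_mem_vRay {u : 𝔼 2} (hu : u ∈ vRay g hg) (hu0 : u ≠ 0) : ang (μk g k) u = π / g := by
  obtain ⟨r, ⟨hr0, -⟩, rfl⟩ := hu
  obtain ⟨h0, h1, h3, -, -, -, -, -⟩ := fan2_window hg hk hkg
  have hu0' : pol r (π / g) ≠ 0 := hu0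
  have hr : 0 < r := by
    rcases hr0.eq_or_lt with h | h
    · exfalso; apply hu0'; rw [← h, pol_zero_left]
    · exact h
  show ang (μk g k) (pol r (π / g)) = π / g
  exact ang_pol hr ⟨by linarith, by linarith⟩

/-- The lower edge ray lies in the fan and the collar region. [folklore] -/
theorem vRay_subset_fanF : vRay g hg ⊆ fanF g k ∩ collarU2 g k := by
  intro u hu
  obtain ⟨h0, h1, h3, -, -, h6, -, h8⟩ := fan2_window hg hk hkg
  have hg1 : 1 ≤ g := by omega
  obtain ⟨r, ⟨hr0, hr4⟩, rfl⟩ := id hu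
  have hq : flower g (pol r (π / g)) ≤ level g := by
    rw [flower_pol_valley hg1]; exact (vprof_le_level_iff hg hr0).2 hr4
  show pol r (π / g) ∈ fanF g k ∩ collarU2 g k
  by_cases hu0 : pol r (π / g) = 0
  · rw [hu0]
    exact ⟨⟨by rw [flower_zero hg1]; exact (level_pos hg1).le, by rw [ang_zero, h6]; constructor <;> linarith⟩,
      Or.inl (Or.inl (mem_ball_self (by norm_num)))⟩
  · have hang := ang_of_mem_vRay hg hk hkg hu hu0
    refine ⟨⟨hq, by rw [hang, h6]; constructor <;> linarith⟩, ?_⟩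
    rcases lt_or_ge ‖pol r (π / g)‖ (1 / 8) with hsmall | hbig
    · exact Or.inl (Or.inl (by rwa [mem_ball, dist_zero_right]))
    · exact Or.inl (Or.inr ⟨hu0, by rw [hang]; linarith, by rw [hang]; linarith⟩)

/-- **The deformation fixes the two edge ray segments.** [folklore] -/
theorem Ψ2_eq_self_of_mem_vRay2 (s : ℝ) {u : 𝔼 2} (hu : u ∈ vRay2 g k hg) : Ψ2 hg (k := k) s u = u := by
  obtain ⟨h0, h1, h3, -, -, h6, -, -⟩ := fan2_window hg hk hkg
  rcases hu with hu | ⟨v, hv, rfl⟩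
  · have h : ang (μk g k) u ≤ μk g k := by
      by_cases hu0 : u = 0
      · rw [hu0, ang_zero]
      · rw [ang_of_mem_vRay hg hk hkg hu hu0]; linarith
    rw [Ψ2_of_le hg h]; exact loΦ_eq_self_of_mem_vRay hg hk hkg s hu
  · have hvF := (vRay_subset_fanF hg hk hkg hv).1
    have hmem := bisRefl_mem_fanF hg hk hkg hvF
    have hmemU := bisRefl_mem_collarU2 hg hk hkg hvF (vRay_subset_fanF hg hk hkg hv).2
    have h : μk g k ≤ ang (μk g k) (bisRefl g k v) := by
      rw [ang_bisRefl hg hk hkg hvF]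
      by_cases hv0 : v = 0
      · rw [hv0, ang_zero]; linarith
      · rw [ang_of_mem_vRay hg hk hkg hv hv0]; linarith
    rw [Ψ2_of_ge hg hk hkg hmem hmemU h, bisRefl_bisRefl hg, loΦ_eq_self_of_mem_vRay hg hk hkg s hv]

/-- The two edge ray segments lie in the fan and in the collar region. [folklore] -/
theorem vRay2_subset : vRay2 g k hg ⊆ fanF g k ∩ collarU2 g k := by
  rintro u (hu | ⟨v, hv, rfl⟩)
  · exact vRay_subset_fanF hg hk hkg hu
  · have h := vRay_subset_fanF hg hk hkg hv
    exact ⟨bisRefl_mem_fanF hg hk hkg h.1, bisRefl_mem_collarU2 hg hk hkg h.1 h.2⟩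

/-- **Continuity of the full collar deformation** on `ℝ × (fan ∩ collar region)` (pasting the two
branches along the bisector, where they agree). [folklore] -/
theorem continuousOn_Ψ2 : ContinuousOn (fun x : ℝ × 𝔼 2 => Ψ2 hg (k := k) x.1 x.2) ((univ : Set ℝ) ×ˢ (fanF g k ∩ collarU2 g k)) := by
  set D : Set (𝔼 2) := fanF g k ∩ collarU2 g k with hD
  set Slo : Set (ℝ × 𝔼 2) := (univ : Set ℝ) ×ˢ (D ∩ {u | ang (μk g k) u ≤ μk g k}) with hSlo
  set Shi : Set (ℝ × 𝔼 2) := (univ : Set ℝ) ×ˢ (D ∩ {u | μk g k < ang (μk g k) u}) with hShi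
  have hcover : (univ : Set ℝ) ×ˢ D = Slo ∪ Shi := by
    ext ⟨t, u⟩
    simp only [hSlo, hShi, mem_prod, mem_univ, true_and, mem_inter_iff, mem_setOf_eq, mem_union]
    constructor
    · intro h; rcases le_or_gt (ang (μk g k) u) (μk g k) with h' | h'
      · exact Or.inl ⟨h, h'⟩
      · exact Or.inr ⟨h, h'⟩
    · rintro (⟨h, -⟩ | ⟨h, -⟩) <;> exact h
  -- the two branches
  have hlo : ContinuousOn (fun x : ℝ × 𝔼 2 => loΦ hg k x.1 x.2) Slo :=
    (continuousOn_loΦ hg hk hkg).mono (prod_mono le_rfl fun u hu => ⟨⟨hu.1.1.1, hu.1.1.2.1, hu.2⟩, hu.1.2⟩)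
  have hmaps : MapsTo (fun x : ℝ × 𝔼 2 => (x.1, bisRefl g k x.2)) ((univ : Set ℝ) ×ˢ (D ∩ {u | μk g k ≤ ang (μk g k) u}))
      ((univ : Set ℝ) ×ˢ (fanFlo g k ∩ collarU2 g k)) := by
    rintro ⟨t, u⟩ ⟨-, ⟨hu, hU⟩, hup⟩
    exact ⟨mem_univ _, bisRefl_mem_fanFlo hg hk hkg hu hup, bisRefl_mem_collarU2 hg hk hkg hu hU⟩
  have hhi' : ContinuousOn (fun x : ℝ × 𝔼 2 => bisRefl g k (loΦ hg k x.1 (bisRefl g k x.2)))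
      ((univ : Set ℝ) ×ˢ (D ∩ {u | μk g k ≤ ang (μk g k) u})) := by
    have hinner : Continuous fun x : ℝ × 𝔼 2 => (x.1, bisRefl g k x.2) := continuous_fst.prodMk (continuous_bisRefl.comp continuous_snd)
    show ContinuousOn (bisRefl g k ∘ (fun x : ℝ × 𝔼 2 => loΦ hg k x.1 x.2) ∘ fun x : ℝ × 𝔼 2 => (x.1, bisRefl g k x.2)) _
    exact continuous_bisRefl.comp_continuousOn ((continuousOn_loΦ hg hk hkg).comp hinner.continuousOn hmaps)
  -- pointwise pasting
  rintro ⟨t, u⟩ ⟨-, huD⟩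
  rw [hcover]
  refine ContinuousWithinAt.union ?_ ?_
  · -- within the lower piece
    by_cases h : ang (μk g k) u ≤ μk g k
    · refine (hlo.continuousWithinAt ⟨mem_univ _, huD, h⟩).congr (fun x hx => ?_) ?_
      · exact Ψ2_of_le hg hx.2.2
      · exact Ψ2_of_le hg h
    · -- `u` is strictly above the bisector: the lower piece stays away from `u`
      push Not at h
      refine continuousWithinAt_of_notMem_closure fun hcl => ?_
      have hu0 : u ≠ 0 := fun h0 => by rw [h0, ang_zero] at h; exact lt_irrefl _ h
      have hc : ContinuousAt (fun x : ℝ × 𝔼 2 => ang (μk g k) x.2) (t, u) :=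
        (continuousAt_ang_of_mem_fanF hg hk hkg huD.1 hu0).comp_of_eq continuous_snd.continuousAt rfl
      have hev : ∀ᶠ x : ℝ × 𝔼 2 in 𝓝 (t, u), μk g k < ang (μk g k) x.2 := hc.eventually (lt_mem_nhds h)
      rw [mem_closure_iff_nhds] at hcl
      obtain ⟨x, hx, hxS⟩ := hcl _ hev
      have hle : ang (μk g k) x.2 ≤ μk g k := hxS.2.2
      exact absurd hle (not_le.2 hx)
  · -- within the upper piece
    by_cases h : μk g k ≤ ang (μk g k) u
    · have hcont := hhi'.continuousWithinAt ⟨mem_univ _, huD, h⟩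
      refine (hcont.mono (prod_mono le_rfl fun v hv => ⟨hv.1, le_of_lt (hv.2 : μk g k < ang (μk g k) v)⟩)).congr
        (fun x hx => ?_) ?_
      · exact Ψ2_of_ge hg hk hkg hx.2.1.1 hx.2.1.2 (le_of_lt (hx.2.2 : μk g k < ang (μk g k) x.2))
      · exact Ψ2_of_ge hg hk hkg huD.1 huD.2 h
    · push Not at h
      refine continuousWithinAt_of_notMem_closure fun hcl => ?_
      have hu0 : u ≠ 0 := fun h0 => by rw [h0, ang_zero] at h; exact lt_irrefl _ h
      have hc : ContinuousAt (fun x : ℝ × 𝔼 2 => ang (μk g k) x.2) (t, u) :=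
        (continuousAt_ang_of_mem_fanF hg hk hkg huD.1 hu0).comp_of_eq continuous_snd.continuousAt rfl
      have hev : ∀ᶠ x : ℝ × 𝔼 2 in 𝓝 (t, u), ang (μk g k) x.2 < μk g k := hc.eventually (gt_mem_nhds h)
      rw [mem_closure_iff_nhds] at hcl
      obtain ⟨x, hx, hxS⟩ := hcl _ hev
      have hlt : μk g k < ang (μk g k) x.2 := hxS.2.2
      exact absurd hlt (not_lt.2 hx.le)

/-- **The collar of the two edge arcs in the two-edged fan**: over the open collar region the
flower surface over the fan strong deformation retracts onto the two edge arcs. [folklore] -/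
theorem isStrongDeformationRetractOf_vRay2 :
    IsStrongDeformationRetractOf ({p | thicken (flower g) p = level g} ∩ proj ⁻¹' vRay2 g k hg)
      ({p | thicken (flower g) p = level g} ∩ proj ⁻¹' (fanF g k ∩ collarU2 g k)) :=
  isStrongDeformationRetractOf_double' (q := flower g) (c := level g) contDiff_flower.continuous
    (W := fanF g k ∩ collarU2 g k) (K := vRay2 g k hg) (Ψ2 hg (k := k))
    ((continuousOn_Ψ2 hg hk hkg).mono (prod_mono (subset_univ _) le_rfl))
    (fun _ hs _ hu => Ψ2_mem hg hk hkg hs hu.1 hu.2) (fun _ hu => hu.1.1)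
    (fun _ hs _ hu hq => flower_Ψ2_eq hg hk hkg hs hu.1 hu.2 hq) (fun _ hu => Ψ2_zero hg hk hkg hu.1 hu.2)
    (fun _ hu => Ψ2_one_mem hg hk hkg hu.1 hu.2)
    (fun s _ _ _ huK => Ψ2_eq_self_of_mem_vRay2 hg hk hkg s huK)

/-- **The two-edged collar region is open.** [folklore] -/
theorem isOpen_collarU2 : IsOpen (collarU2 g k) := by
  obtain ⟨h0, h1, h3, h4, h5, h6, -, -⟩ := fan2_window hg hk hkg
  have key : ∀ a b : ℝ, μk g k - π < a → b ≤ μk g k + π →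
      IsOpen {u : 𝔼 2 | u ≠ 0 ∧ a < ang (μk g k) u ∧ ang (μk g k) u < b} := by
    intro a b ha hb
    rw [isOpen_iff_mem_nhds]
    rintro u ⟨hu0, hua, hub⟩
    have hcut : ang (μk g k) u ≠ μk g k + π := by intro h; rw [h] at hub; linarith
    have hc : ContinuousAt (ang (μk g k)) u := continuousAt_ang hu0 hcut
    have hn1 : {v : 𝔼 2 | v ≠ 0} ∈ 𝓝 u := isOpen_ne.mem_nhds hu0
    have hn2 : ang (μk g k) ⁻¹' Ioo a b ∈ 𝓝 u := hc.preimage_mem_nhds (isOpen_Ioo.mem_nhds ⟨hua, hub⟩)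
    filter_upwards [hn1, hn2] with v hv1 hv2
    exact ⟨hv1, hv2.1, hv2.2⟩
  exact (isOpen_ball.union (key _ _ h4 (by linarith))).union (key _ _ (by rw [h6]; linarith) h5)

end TwoRay

end FlowerModel

end Literature.Topology.FourManifolds
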